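import Literature.Analysis.FluidPDE.TorusNSChaeLeeCriterion
import Literature.Analysis.FluidPDE.TorusNSLambDepletionFractional

/-!
# Chae–Lee 2017, Thm 1 (ii) on `T³` in its full printed exponent range
# `γ ∈ (3, ∞]`, `α ∈ [2, ∞]`, `3/γ + 2/α ≤ 1` (levels `β = 2` and `1 < β < 2`)

Analysis/FluidPDE proof file (theorems only; no definitions, no named facts).

search for candidate a priori estimates; no regularity claim (cell `pub-nsfunc`, literature seat:
this file completes the typing of a PUBLISHED conditional regularity criterion; nothing new).

Source: D. Chae, J. Lee, *On the geometric regularity conditions for the 3D Navier–Stokes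
equations*, Nonlinear Anal. 151 (2017) 265–273 (= arXiv:1606.08126), Theorem 1 (ii) and its proof
(§2). Printed (ℝ³; `Λ = (−Δ)^{1/2}`, `{f}₊ = max{f, 0}`, direction fields set to `0` where `ω = 0`
or `Λ^β v = 0`; `‖·‖_{L^{γ,α}_{x,t}} = ‖‖·‖_{L^γ_x}‖_{L^α_t}`):

"**Theorem 1.** Let `v` be a local in time regular solution of (NS) in `Q_T := ℝ³ × (0, T)` with
`v₀ ∈ H^{1/2}(ℝ³)`. Then … (ii) `v` blows up at `T_*`, which is a finite maximal time of local in
time smooth solution to (NS), namely, `limsup_{t ↗ T_*} ‖v(t)‖_{H^m} = ∞, ∀ m ≥ 1/2`, if and only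
if for all `γ ∈ (3, ∞]` and `α ∈ [2, ∞]` with `3/γ + 2/α ≤ 1` and all `β ∈ [1, 2]`
`‖{(v × ω/|ω|)·(Λ^β v/|Λ^β v|)}₊‖_{L^{γ,α}_{x,t}(Q_T)} = ∞`."

The companions `TorusNSChaeLeeCriterion` (`β = 2`) and `TorusNSLambDepletionFractional`
(`1 < β < 2`) type the SCALE-INVARIANT line `3/γ + 2/α = 1` of this range (finite `γ` with
`α = 2γ/(γ−3)`; `γ = ∞` with `α = 2`) in continuation form — a continuous majorant
`N(t) ≥ ‖κ(t)‖_{L^γ}` with `∫₀ᵗ N^{2γ/(γ−3)} ≤ I` on `[0, T)` — and record in their Scope that the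
rest of the printed range ("on a bounded interval `< 1` reduces to it by Hölder in time") is not
done. This file does it, for both levels, in the depletion-factor form (any admissible `κ`) and in
the printed positive-part form, by ONE elementary step in time on the bounded interval `[0, T)`
(Young's inequality `N^{α₀} ≤ (α₀/α)N^α + (1 − α₀/α)`, `α₀ = 2γ/(γ−3) ≤ α`, integrated:
`∫₀ᵗ N^{α₀} ≤ (α₀/α) I + (1 − α₀/α) T`; a constant majorant for `α = ∞`). The four faces of the
printed range `{3/γ + 2/α ≤ 1}`:

* (A) `3 < γ < ∞`, `2γ/(γ−3) ≤ α < ∞` — hypothesis typed LITERALLY as `3 / γ + 2 / α ≤ 1` with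
  `∫₀ᵗ N^α ≤ I`: `Torus.classicalNS_continuation_of_lambDepletion_rpow_integral_le_of_exponents`,
  `Torus.classicalNS_continuation_of_posPart_tripleProduct_rpow_integral_le_of_exponents` (`β = 2`);
  `Torus.classicalNS_continuation_of_lambDepletion_frac_rpow_integral_le_of_exponents`,
  `Torus.classicalNS_continuation_of_posPart_tripleProduct_frac_rpow_integral_le_of_exponents`
  (`1 < β < 2`, with the parents' UNIFORM Grönwall constant `K` and the bound
  `X_{β/2}(t) + 4π²ν∫₀ᵗX_{β/2+1} ≤ e^{K((α₀/α)I + (1−α₀/α)T)} X_{β/2}(0)`).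
* (B) `3 < γ < ∞`, `α = ∞` — `‖κ(t)‖_{L^γ} ≤ M` for all `t`: `…_lambDepletion_Lp_le`,
  `…_posPart_tripleProduct_Lp_le`, `…_lambDepletion_frac_Lp_le`,
  `…_posPart_tripleProduct_frac_Lp_le`.
* (C) `γ = ∞`, `2 ≤ α < ∞` — `κ(t,·) ≤ N(t)`, `∫₀ᵗ N^α ≤ I`: `…_lambDepletion_sup_rpow_integral_le`,
  `…_posPart_tripleProduct_sup_rpow_integral_le`, `…_frac_sup_rpow_integral_le` (two forms;
  explicit bound `e^{2((2/α)I + (1−2/α)T)/ν}` at `1 < β < 2`).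
* (D) `γ = α = ∞` — `κ ≤ M`: `…_lambDepletion_sup_le`, `…_posPart_tripleProduct_sup_le`,
  `…_frac_sup_le` (two forms; explicit `e^{2M²T/ν}`).
* The blow-up readings ("`= ∞`" at a blow-up time) on faces (A) and (B):
  `Torus.forall_exists_lt_integral_posPartMajorant_of_not_bddAbove_gradNormSq_of_exponents`,
  `Torus.forall_exists_lt_posPart_tripleProduct_Lp_of_not_bddAbove_gradNormSq` and their `frac`
  twins.

Scope (faithfulness): as the companions — classical solutions with mean-zero slices of the unforced
system on the unit torus (the paper: ℝ³, `H^{1/2}` local solutions), continuation form at a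
putative blow-up time; levels `β = 2` and `1 < β < 2` only (the level `β = 1` of the printed range
is the companion `TorusNSLambDepletionIntegralCriterion` and is NOT treated here); the faces (A) off
the line, (B), (C), (D) are not scale-invariant off the line `3/γ + 2/α = 1`; constants depend on
`T` (displayed in every statement). Nothing here is a monotone quantity: continuation CRITERIA.
-- TODO(general form): `β = 1` faces (B)–(D) and (A) off the line; whole space; Thm 3.

## Mathlib / tree search

Tree (used): `Torus.classicalNS_continuation_of_lambDepletion_rpow_integral_le`,
`Torus.classicalNS_continuation_of_lambDepletion_sup_sq_integral_le`,
`Torus.classicalNS_continuation_of_posPart_tripleProduct_rpow_integral_le`,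
`Torus.classicalNS_continuation_of_posPart_tripleProduct_sup_sq_integral_le`
(`TorusNSChaeLeeCriterion`), their `frac` twins (`TorusNSLambDepletionFractional`),
`ChaeLee2017.posPart_frame_eq`, `NSSobolev.posPart_lambPairing_frame_eq`,
`Torus.classicalNS_not_continuation_of_not_bddAbove_gradNormSq'`
(`TorusClassicalNSMaximalSolution`); Mathlib `Real.geom_mean_le_arith_mean2_weighted`,
`intervalIntegral.integral_mono_on`. Searched (`lean search`):
`of_exponents|Lp_le|sup_rpow_integral_le|3 / s \+ 2 /` in `FluidPDE/TorusNS*` — only the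
scale-invariant line is typed (the companions' Scope says so) — added here.

## References

* [ChaeLee2017] D. Chae, J. Lee, *On the geometric regularity conditions for the 3D Navier–Stokes
  equations*, Nonlinear Anal. 151 (2017) 265–273, doi:10.1016/j.na.2016.10.024, arXiv:1606.08126 —
  Thm 1 (ii) (the exponent range `γ ∈ (3, ∞]`, `α ∈ [2, ∞]`, `3/γ + 2/α ≤ 1`; held text
  `paper:arxiv-1606.08126`, chunk 3) and proof §2.
* [RobinsonRodrigoSadowskiCUP2016] J. C. Robinson, J. L. Rodrigo, W. Sadowski, *The
  Three-Dimensional Navier–Stokes Equations*, CUP 2016, Lemma 6.11 / Thm 8.17 (the continuation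
  door and the Serrin assembly, via the companions).
-/

noncomputable section

open Set MeasureTheory intervalIntegral Filter Real UnitAddTorus

namespace Literature.Analysis.FluidPDE

open Literature.Analysis.FunctionSpaces Literature.Analysis.FunctionSpaces.Torus

variable {d : Type*} [Fintype d] [DecidableEq d]

/-! ### §1 The step in time: Young's inequality on a bounded interval, and the exponent algebra -/

namespace ChaeLee2017

/-- Young's inequality with weights `r₀/r` and `1 − r₀/r`: `x^{r₀} ≤ (r₀/r) x^r + (1 − r₀/r)` for
`x ≥ 0`, `0 < r₀ ≤ r`. (Proof device.) [folklore] -/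
private theorem rpow_le_div_mul_rpow_add {x r₀ r : ℝ} (hx : 0 ≤ x) (hr₀ : 0 < r₀) (hr : r₀ ≤ r) :
    x ^ r₀ ≤ r₀ / r * x ^ r + (1 - r₀ / r) := by
  have hrpos : 0 < r := hr₀.trans_le hr
  have hw1 : 0 ≤ r₀ / r := div_nonneg hr₀.le hrpos.le
  have hw2 : 0 ≤ 1 - r₀ / r := sub_nonneg.2 ((div_le_one hrpos).2 hr)
  have h := Real.geom_mean_le_arith_mean2_weighted hw1 hw2 (Real.rpow_nonneg hx r) zero_le_one
    (by ring)
  have h1 : (x ^ r) ^ (r₀ / r) = x ^ r₀ := by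
    rw [← Real.rpow_mul hx]
    congr 1
    field_simp
  rw [h1, Real.one_rpow, mul_one] at h
  linarith

/-- **Hölder/Young in time on a bounded interval** (the printed reduction of the range
`3/γ + 2/α < 1` to the scale-invariant line): for a continuous `N ≥ 0` on `[0, T)` with
`∫₀ᵗ N^r ≤ I` for all `t < T` and `0 < r₀ ≤ r`, `∫₀ᵗ N^{r₀} ≤ (r₀/r) I + (1 − r₀/r) T` for all
`t < T`. (Proof device.) [folklore] -/
private theorem integral_rpow_le_of_integral_rpow_le {N : ℝ → ℝ} {T r₀ r I : ℝ}
    (hNc : ContinuousOn N (Ico 0 T)) (hN0 : ∀ t ∈ Ico 0 T, 0 ≤ N t) (hr₀ : 0 < r₀) (hr : r₀ ≤ r)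
    (hI : ∀ t ∈ Ico 0 T, ∫ τ in (0 : ℝ)..t, N τ ^ r ≤ I) {t : ℝ} (ht : t ∈ Ico 0 T) :
    ∫ τ in (0 : ℝ)..t, N τ ^ r₀ ≤ r₀ / r * I + (1 - r₀ / r) * T := by
  have ht0 : 0 ≤ t := ht.1
  have hsub : Icc 0 t ⊆ Ico 0 T := Icc_subset_Ico_right ht.2
  have hNc' : ContinuousOn N (Icc 0 t) := hNc.mono hsub
  have hrpos : 0 < r := hr₀.trans_le hr
  have hw1 : 0 ≤ r₀ / r := div_nonneg hr₀.le hrpos.le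
  have hw2 : 0 ≤ 1 - r₀ / r := sub_nonneg.2 ((div_le_one hrpos).2 hr)
  have hint : ∀ q : ℝ, 0 ≤ q → IntervalIntegrable (fun τ => N τ ^ q) volume 0 t := by
    intro q hq
    apply ContinuousOn.intervalIntegrable
    rw [uIcc_of_le ht0]
    exact hNc'.rpow_const fun x _ => Or.inr hq
  have hint2 : IntervalIntegrable (fun τ => r₀ / r * N τ ^ r + (1 - r₀ / r)) volume 0 t :=
    ((hint r hrpos.le).const_mul _).add intervalIntegrable_const
  calc ∫ τ in (0 : ℝ)..t, N τ ^ r₀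
      ≤ ∫ τ in (0 : ℝ)..t, (r₀ / r * N τ ^ r + (1 - r₀ / r)) :=
        intervalIntegral.integral_mono_on ht0 (hint r₀ hr₀.le) hint2
          fun τ hτ => rpow_le_div_mul_rpow_add (hN0 τ (hsub hτ)) hr₀ hr
    _ = r₀ / r * (∫ τ in (0 : ℝ)..t, N τ ^ r) + (1 - r₀ / r) * t := by
        rw [intervalIntegral.integral_add ((hint r hrpos.le).const_mul _) intervalIntegrable_const,
          intervalIntegral.integral_const_mul, intervalIntegral.integral_const, smul_eq_mul]
        ring
    _ ≤ r₀ / r * I + (1 - r₀ / r) * T := by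
        have h1 := hI t ht
        have h2 : t ≤ T := ht.2.le
        gcongr

/-- The integral of a constant majorant: `∫₀ᵗ M^r = t M^r ≤ T M^r` for `0 ≤ t < T`, `M ≥ 0`.
(Proof device.) [folklore] -/
private theorem integral_const_rpow_le {M T r : ℝ} (hM : 0 ≤ M) {t : ℝ} (ht : t ∈ Ico 0 T) :
    ∫ _τ in (0 : ℝ)..t, M ^ r ≤ M ^ r * T := by
  rw [intervalIntegral.integral_const, smul_eq_mul, sub_zero, mul_comm]
  exact mul_le_mul_of_nonneg_left ht.2.le (Real.rpow_nonneg hM r)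

/-- The integral of a constant square majorant: `∫₀ᵗ M² ≤ M² T` for `0 ≤ t < T`.
(Proof device.) [folklore] -/
private theorem integral_const_sq_le {M T : ℝ} {t : ℝ} (ht : t ∈ Ico 0 T) :
    ∫ _τ in (0 : ℝ)..t, M ^ 2 ≤ M ^ 2 * T := by
  rw [intervalIntegral.integral_const, smul_eq_mul, sub_zero, mul_comm]
  exact mul_le_mul_of_nonneg_left ht.2.le (sq_nonneg M)

/-- The exponent algebra of the printed range: for `γ > 3` and `α ≥ 2`, `3/γ + 2/α ≤ 1` iff
`2γ/(γ−3) ≤ α` — here the direction used. (Proof device.) [folklore] -/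
private theorem two_mul_div_sub_three_le {s a : ℝ} (hs : 3 < s) (ha : 2 ≤ a)
    (hsa : 3 / s + 2 / a ≤ 1) : 2 * s / (s - 3) ≤ a := by
  have hs0 : 0 < s := by linarith
  have ha0 : 0 < a := by linarith
  have hs3 : 0 < s - 3 := by linarith
  have h1 : 3 * a + 2 * s ≤ s * a := by
    have h2 : 3 / s + 2 / a = (3 * a + 2 * s) / (s * a) := by
      field_simp
    rw [h2, div_le_one (by positivity)] at hsa
    exact hsa
  rw [div_le_iff₀ hs3]
  nlinarith

/-- On the scale-invariant line the Young step costs the factor recorded in the statements: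
`∫₀ᵗ N^{2γ/(γ−3)} ≤ (α₀/α) I + (1 − α₀/α) T`, `α₀ = 2γ/(γ−3) ≤ α`, from `∫₀ᵗ N^α ≤ I`.
(Proof device.) [folklore] -/
private theorem integral_rpow_crit_le_of_exponents {N : ℝ → ℝ} {T s a I : ℝ} (hs : 3 < s)
    (ha : 2 ≤ a) (hsa : 3 / s + 2 / a ≤ 1)
    (hNc : ContinuousOn N (Ico 0 T)) (hN0 : ∀ t ∈ Ico 0 T, 0 ≤ N t)
    (hI : ∀ t ∈ Ico 0 T, ∫ τ in (0 : ℝ)..t, N τ ^ a ≤ I) {t : ℝ} (ht : t ∈ Ico 0 T) :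
    ∫ τ in (0 : ℝ)..t, N τ ^ (2 * s / (s - 3)) ≤
      (2 * s / (s - 3)) / a * I + (1 - (2 * s / (s - 3)) / a) * T := by
  have hs3 : 0 < s - 3 := by linarith
  have hr₀ : 0 < 2 * s / (s - 3) := by positivity
  exact integral_rpow_le_of_integral_rpow_le hNc hN0 hr₀ (two_mul_div_sub_three_le hs ha hsa) hI ht

/-- The Young step at `γ = ∞`: `∫₀ᵗ N² ≤ (2/α) I + (1 − 2/α) T` from `∫₀ᵗ N^α ≤ I`, `α ≥ 2`.
(Proof device.) [folklore] -/
private theorem integral_sq_le_of_exponent {N : ℝ → ℝ} {T a I : ℝ} (ha : 2 ≤ a)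
    (hNc : ContinuousOn N (Ico 0 T)) (hN0 : ∀ t ∈ Ico 0 T, 0 ≤ N t)
    (hI : ∀ t ∈ Ico 0 T, ∫ τ in (0 : ℝ)..t, N τ ^ a ≤ I) {t : ℝ} (ht : t ∈ Ico 0 T) :
    ∫ τ in (0 : ℝ)..t, N τ ^ 2 ≤ 2 / a * I + (1 - 2 / a) * T := by
  have h1 : ∫ τ in (0 : ℝ)..t, N τ ^ 2 = ∫ τ in (0 : ℝ)..t, N τ ^ (2 : ℝ) :=
    intervalIntegral.integral_congr fun τ _ => (Real.rpow_two (N τ)).symm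
  rw [h1]
  exact integral_rpow_le_of_integral_rpow_le hNc hN0 two_pos ha hI ht

end ChaeLee2017

/-! ### §2 Level `β = 2` (the enstrophy level): depletion-factor form -/

section BetaTwoFactor

variable {ν T : ℝ} {u : ℝ → UnitAddTorus d → EuclideanSpace ℝ d} {p : ℝ → UnitAddTorus d → ℝ}

/-- **Chae–Lee's criterion on `T³` at `β = 2`, depletion-factor form, face (A) of the printed range:
`3 < γ < ∞`, `2 ≤ α < ∞`, `3/γ + 2/α ≤ 1`.** Let `(u, p)` be a classical solution of the unforced
Navier–Stokes equations (`ν > 0`) on `[0, T) × T^d`, `card d = 3`, `T > 0`, with mean-zero velocity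
slices; let a bounded measurable `κ(t, ·) ≥ 0` dominate the Lamb–Laplacian pairing,
`(ω × u)·Δu ≤ κ|ω||Δu|` pointwise, and let a continuous `N ≥ 0` have `(∫κ(t)^γ)^{1/γ} ≤ N(t)` and
`∫₀ᵗ N^α ≤ I` on `[0, T)`, where `3/γ + 2/α ≤ 1` (typed literally). Then the solution continues to
a classical solution with mean-zero slices on some `[0, T'] × T^d`, `T' > T`, equal to `u` on
`[0, T)`. Proof: on the bounded interval `∫₀ᵗ N^{2γ/(γ−3)} ≤ (α₀/α)I + (1 − α₀/α)T`
(Young in time), and the scale-invariant case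
`Torus.classicalNS_continuation_of_lambDepletion_rpow_integral_le` applies.
[cite: ChaeLee2017, Thm 1 (ii) (β = 2, 3 < γ < ∞, 2 ≤ α < ∞, 3/γ + 2/α ≤ 1; proof §2)] -/
theorem Torus.classicalNS_continuation_of_lambDepletion_rpow_integral_le_of_exponents
    (hd : Fintype.card d = 3) {s a : ℝ} (hν : 0 < ν) (hT : 0 < T) (hs : 3 < s) (ha : 2 ≤ a)
    (hsa : 3 / s + 2 / a ≤ 1)
    (h : Torus.IsClassicalNSSolutionOn (Ico 0 T) ν 0 u p)
    (hmean : ∀ t ∈ Ico 0 T, Torus.HasZeroMean (u t)) {κ : ℝ → UnitAddTorus d → ℝ}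
    (hκm : ∀ t ∈ Ico 0 T, AEStronglyMeasurable (κ t) volume)
    (hκ0 : ∀ t ∈ Ico 0 T, ∀ x, 0 ≤ κ t x) (hκB : ∀ t ∈ Ico 0 T, ∃ B : ℝ, ∀ x, κ t x ≤ B)
    (hdep : ∀ t ∈ Ico 0 T, ∀ x,
      ∑ i, ∑ j, u t x j * torusVorticityTensor (u t) j i x * Torus.laplacian (u t) x i ≤
        κ t x * Real.sqrt (torusVorticitySqAt (u t) x) * ‖Torus.laplacian (u t) x‖)
    {N : ℝ → ℝ} (hNc : ContinuousOn N (Ico 0 T)) (hN0 : ∀ t ∈ Ico 0 T, 0 ≤ N t)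
    (hN : ∀ t ∈ Ico 0 T, (∫ x, κ t x ^ s) ^ (1 / s) ≤ N t)
    {I : ℝ} (hI : ∀ t ∈ Ico 0 T, ∫ τ in (0 : ℝ)..t, N τ ^ a ≤ I) :
    ∃ T' : ℝ, T < T' ∧ ∃ (u' : ℝ → UnitAddTorus d → EuclideanSpace ℝ d)
      (p' : ℝ → UnitAddTorus d → ℝ), Torus.IsClassicalNSSolutionOn (Icc 0 T') ν 0 u' p' ∧
        (∀ t ∈ Icc 0 T', Torus.HasZeroMean (u' t)) ∧ ∀ t ∈ Ico 0 T, u' t = u t :=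
  Torus.classicalNS_continuation_of_lambDepletion_rpow_integral_le hd hν hT hs h hmean hκm hκ0 hκB
    hdep hNc hN0 hN
    (I := (2 * s / (s - 3)) / a * I + (1 - (2 * s / (s - 3)) / a) * T)
    fun _ ht => ChaeLee2017.integral_rpow_crit_le_of_exponents hs ha hsa hNc hN0 hI ht

/-- **Face (B) at `β = 2`, depletion-factor form: `3 < γ < ∞`, `α = ∞`** — `‖κ(t)‖_{L^γ} ≤ M` for
all `t ∈ [0, T)` (`(∫κ(t)^γ)^{1/γ} ≤ M`) ⇒ the classical mean-zero solution continues past `T`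
(constant majorant, `∫₀ᵗ M^{2γ/(γ−3)} ≤ M^{2γ/(γ−3)} T`).
[cite: ChaeLee2017, Thm 1 (ii) (β = 2, 3 < γ < ∞, α = ∞; proof §2)] -/
theorem Torus.classicalNS_continuation_of_lambDepletion_Lp_le
    (hd : Fintype.card d = 3) {s : ℝ} (hν : 0 < ν) (hT : 0 < T) (hs : 3 < s)
    (h : Torus.IsClassicalNSSolutionOn (Ico 0 T) ν 0 u p)
    (hmean : ∀ t ∈ Ico 0 T, Torus.HasZeroMean (u t)) {κ : ℝ → UnitAddTorus d → ℝ}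
    (hκm : ∀ t ∈ Ico 0 T, AEStronglyMeasurable (κ t) volume)
    (hκ0 : ∀ t ∈ Ico 0 T, ∀ x, 0 ≤ κ t x) (hκB : ∀ t ∈ Ico 0 T, ∃ B : ℝ, ∀ x, κ t x ≤ B)
    (hdep : ∀ t ∈ Ico 0 T, ∀ x,
      ∑ i, ∑ j, u t x j * torusVorticityTensor (u t) j i x * Torus.laplacian (u t) x i ≤
        κ t x * Real.sqrt (torusVorticitySqAt (u t) x) * ‖Torus.laplacian (u t) x‖)
    {M : ℝ} (hM : ∀ t ∈ Ico 0 T, (∫ x, κ t x ^ s) ^ (1 / s) ≤ M) :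
    ∃ T' : ℝ, T < T' ∧ ∃ (u' : ℝ → UnitAddTorus d → EuclideanSpace ℝ d)
      (p' : ℝ → UnitAddTorus d → ℝ), Torus.IsClassicalNSSolutionOn (Icc 0 T') ν 0 u' p' ∧
        (∀ t ∈ Icc 0 T', Torus.HasZeroMean (u' t)) ∧ ∀ t ∈ Ico 0 T, u' t = u t := by
  have h0T : (0 : ℝ) ∈ Ico 0 T := ⟨le_rfl, hT⟩
  have hM0 : 0 ≤ M := (Real.rpow_nonneg (integral_nonneg fun x =>
    Real.rpow_nonneg (hκ0 0 h0T x) _) _).trans (hM 0 h0T)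
  exact Torus.classicalNS_continuation_of_lambDepletion_rpow_integral_le hd hν hT hs h hmean hκm hκ0
    hκB hdep (N := fun _ => M) continuousOn_const (fun _ _ => hM0) hM
    (I := M ^ (2 * s / (s - 3)) * T) fun _ ht => ChaeLee2017.integral_const_rpow_le hM0 ht

/-- **Face (C) at `β = 2`, depletion-factor form: `γ = ∞`, `2 ≤ α < ∞`** — `κ(t, ·) ≤ N(t)` for a
continuous `N ≥ 0` with `∫₀ᵗ N^α ≤ I` on `[0, T)` ⇒ continuation past `T`
(`∫₀ᵗ N² ≤ (2/α)I + (1 − 2/α)T` and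
`Torus.classicalNS_continuation_of_lambDepletion_sup_sq_integral_le`).
[cite: ChaeLee2017, Thm 1 (ii) (β = 2, γ = ∞, 2 ≤ α < ∞; proof §2)] -/
theorem Torus.classicalNS_continuation_of_lambDepletion_sup_rpow_integral_le
    (hd : Fintype.card d = 3) {a : ℝ} (hν : 0 < ν) (hT : 0 < T) (ha : 2 ≤ a)
    (h : Torus.IsClassicalNSSolutionOn (Ico 0 T) ν 0 u p)
    (hmean : ∀ t ∈ Ico 0 T, Torus.HasZeroMean (u t)) {κ : ℝ → UnitAddTorus d → ℝ}
    (hdep : ∀ t ∈ Ico 0 T, ∀ x,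
      ∑ i, ∑ j, u t x j * torusVorticityTensor (u t) j i x * Torus.laplacian (u t) x i ≤
        κ t x * Real.sqrt (torusVorticitySqAt (u t) x) * ‖Torus.laplacian (u t) x‖)
    {N : ℝ → ℝ} (hNc : ContinuousOn N (Ico 0 T)) (hN0 : ∀ t ∈ Ico 0 T, 0 ≤ N t)
    (hκN : ∀ t ∈ Ico 0 T, ∀ x, κ t x ≤ N t)
    {I : ℝ} (hI : ∀ t ∈ Ico 0 T, ∫ τ in (0 : ℝ)..t, N τ ^ a ≤ I) :
    ∃ T' : ℝ, T < T' ∧ ∃ (u' : ℝ → UnitAddTorus d → EuclideanSpace ℝ d)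
      (p' : ℝ → UnitAddTorus d → ℝ), Torus.IsClassicalNSSolutionOn (Icc 0 T') ν 0 u' p' ∧
        (∀ t ∈ Icc 0 T', Torus.HasZeroMean (u' t)) ∧ ∀ t ∈ Ico 0 T, u' t = u t :=
  Torus.classicalNS_continuation_of_lambDepletion_sup_sq_integral_le hd hν hT h hmean hdep hNc hN0
    hκN (I := 2 / a * I + (1 - 2 / a) * T)
    fun _ ht => ChaeLee2017.integral_sq_le_of_exponent ha hNc hN0 hI ht

/-- **Face (D) at `β = 2`, depletion-factor form: `γ = α = ∞`** — `κ ≤ M` pointwise on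
`[0, T) × T^d`, `M ≥ 0` ⇒ continuation past `T` (constant majorant, `∫₀ᵗ M² ≤ M² T`).
[cite: ChaeLee2017, Thm 1 (ii) (β = 2, γ = α = ∞; proof §2)] -/
theorem Torus.classicalNS_continuation_of_lambDepletion_sup_le
    (hd : Fintype.card d = 3) (hν : 0 < ν) (hT : 0 < T)
    (h : Torus.IsClassicalNSSolutionOn (Ico 0 T) ν 0 u p)
    (hmean : ∀ t ∈ Ico 0 T, Torus.HasZeroMean (u t)) {κ : ℝ → UnitAddTorus d → ℝ}
    (hdep : ∀ t ∈ Ico 0 T, ∀ x,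
      ∑ i, ∑ j, u t x j * torusVorticityTensor (u t) j i x * Torus.laplacian (u t) x i ≤
        κ t x * Real.sqrt (torusVorticitySqAt (u t) x) * ‖Torus.laplacian (u t) x‖)
    {M : ℝ} (hM0 : 0 ≤ M) (hκM : ∀ t ∈ Ico 0 T, ∀ x, κ t x ≤ M) :
    ∃ T' : ℝ, T < T' ∧ ∃ (u' : ℝ → UnitAddTorus d → EuclideanSpace ℝ d)
      (p' : ℝ → UnitAddTorus d → ℝ), Torus.IsClassicalNSSolutionOn (Icc 0 T') ν 0 u' p' ∧
        (∀ t ∈ Icc 0 T', Torus.HasZeroMean (u' t)) ∧ ∀ t ∈ Ico 0 T, u' t = u t :=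
  Torus.classicalNS_continuation_of_lambDepletion_sup_sq_integral_le hd hν hT h hmean hdep
    (N := fun _ => M) continuousOn_const (fun _ _ => hM0) hκM (I := M ^ 2 * T)
    fun _ ht => ChaeLee2017.integral_const_sq_le ht

end BetaTwoFactor

/-! ### §3 Level `β = 2`: the printed factor `{(u × ω/|ω|)·(−Δu/|Δu|)}₊` in a frame -/

section BetaTwoPrinted

variable {ν T : ℝ} {u : ℝ → UnitAddTorus d → EuclideanSpace ℝ d} {p : ℝ → UnitAddTorus d → ℝ}

/-- **Chae–Lee 2017, Thm 1 (ii) at `β = 2` on `T³` — the printed form on face (A) of the printed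
range: `3 < γ < ∞`, `2 ≤ α < ∞`, `3/γ + 2/α ≤ 1`.** Printed: "`v` blows up at `T_*` … if and
only if for all `γ ∈ (3, ∞]` and `α ∈ [2, ∞]` with `3/γ + 2/α ≤ 1` and all `β ∈ [1, 2]`,
`‖{(v × ω/|ω|)·(Λ^β v/|Λ^β v|)}₊‖_{L^{γ,α}_{x,t}(Q_T)} = ∞`". Here on the unit torus (`card d = 3`
via a frame `e`, `ωₖ = W_{k⁺k⁺⁺}(u(t))`, `κ(t,x) := max{0, (u × ω)·(−Δu)/(|ω||Δu|)}`), in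
continuation form: a classical mean-zero solution of the unforced equations (`ν > 0`) on
`[0, T) × T^d`, `T > 0`, with a continuous `N ≥ 0`, `(∫κ(t)^γ)^{1/γ} ≤ N(t)` and `∫₀ᵗ N^α ≤ I` on
`[0, T)`, `3/γ + 2/α ≤ 1`, continues to a classical mean-zero solution on some `[0, T'] × T^d`,
`T' > T`, equal to `u` on `[0, T)` — `T` is not a blow-up time. The line `3/γ + 2/α = 1`:
`Torus.classicalNS_continuation_of_posPart_tripleProduct_rpow_integral_le`.
[cite: ChaeLee2017, Thm 1 (ii) (β = 2, 3 < γ < ∞, 2 ≤ α < ∞, 3/γ + 2/α ≤ 1; proof §2)] -/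
theorem Torus.classicalNS_continuation_of_posPart_tripleProduct_rpow_integral_le_of_exponents
    (e : d ≃ Fin 3) {s a : ℝ} (hν : 0 < ν) (hT : 0 < T) (hs : 3 < s) (ha : 2 ≤ a)
    (hsa : 3 / s + 2 / a ≤ 1)
    (h : Torus.IsClassicalNSSolutionOn (Ico 0 T) ν 0 u p)
    (hmean : ∀ t ∈ Ico 0 T, Torus.HasZeroMean (u t)) {w : ℝ → d → UnitAddTorus d → ℝ}
    (hw : ∀ t k x, w t k x = torusVorticityTensor (u t) (e.symm (e k + 1)) (e.symm (e k + 2)) x)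
    {N : ℝ → ℝ} (hNc : ContinuousOn N (Ico 0 T)) (hN0 : ∀ t ∈ Ico 0 T, 0 ≤ N t)
    (hN : ∀ t ∈ Ico 0 T, (∫ x, (max 0 ((∑ k, (u t x (e.symm (e k + 1)) * w t (e.symm (e k + 2)) x -
          u t x (e.symm (e k + 2)) * w t (e.symm (e k + 1)) x) * (-Torus.laplacian (u t) x k)) /
          (Real.sqrt (∑ k, w t k x ^ 2) * ‖Torus.laplacian (u t) x‖))) ^ s) ^ (1 / s) ≤ N t)
    {I : ℝ} (hI : ∀ t ∈ Ico 0 T, ∫ τ in (0 : ℝ)..t, N τ ^ a ≤ I) :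
    ∃ T' : ℝ, T < T' ∧ ∃ (u' : ℝ → UnitAddTorus d → EuclideanSpace ℝ d)
      (p' : ℝ → UnitAddTorus d → ℝ), Torus.IsClassicalNSSolutionOn (Icc 0 T') ν 0 u' p' ∧
        (∀ t ∈ Icc 0 T', Torus.HasZeroMean (u' t)) ∧ ∀ t ∈ Ico 0 T, u' t = u t :=
  Torus.classicalNS_continuation_of_posPart_tripleProduct_rpow_integral_le e hν hT hs h hmean hw
    hNc hN0 hN (I := (2 * s / (s - 3)) / a * I + (1 - (2 * s / (s - 3)) / a) * T)
    fun _ ht => ChaeLee2017.integral_rpow_crit_le_of_exponents hs ha hsa hNc hN0 hI ht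

/-- **Thm 1 (ii) at `β = 2` on `T³`, printed form, face (B): `3 < γ < ∞`, `α = ∞`** —
`‖κ(t)‖_{L^γ} ≤ M` for all `t ∈ [0, T)` (`κ = {(u × ω/|ω|)·(−Δu/|Δu|)}₊` in the frame `e`) ⇒ the
classical mean-zero solution continues past `T`.
[cite: ChaeLee2017, Thm 1 (ii) (β = 2, 3 < γ < ∞, α = ∞; proof §2)] -/
theorem Torus.classicalNS_continuation_of_posPart_tripleProduct_Lp_le
    (e : d ≃ Fin 3) {s : ℝ} (hν : 0 < ν) (hT : 0 < T) (hs : 3 < s)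
    (h : Torus.IsClassicalNSSolutionOn (Ico 0 T) ν 0 u p)
    (hmean : ∀ t ∈ Ico 0 T, Torus.HasZeroMean (u t)) {w : ℝ → d → UnitAddTorus d → ℝ}
    (hw : ∀ t k x, w t k x = torusVorticityTensor (u t) (e.symm (e k + 1)) (e.symm (e k + 2)) x)
    {M : ℝ}
    (hM : ∀ t ∈ Ico 0 T, (∫ x, (max 0 ((∑ k, (u t x (e.symm (e k + 1)) * w t (e.symm (e k + 2)) x -
          u t x (e.symm (e k + 2)) * w t (e.symm (e k + 1)) x) * (-Torus.laplacian (u t) x k)) /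
          (Real.sqrt (∑ k, w t k x ^ 2) * ‖Torus.laplacian (u t) x‖))) ^ s) ^ (1 / s) ≤ M) :
    ∃ T' : ℝ, T < T' ∧ ∃ (u' : ℝ → UnitAddTorus d → EuclideanSpace ℝ d)
      (p' : ℝ → UnitAddTorus d → ℝ), Torus.IsClassicalNSSolutionOn (Icc 0 T') ν 0 u' p' ∧
        (∀ t ∈ Icc 0 T', Torus.HasZeroMean (u' t)) ∧ ∀ t ∈ Ico 0 T, u' t = u t := by
  have h0T : (0 : ℝ) ∈ Ico 0 T := ⟨le_rfl, hT⟩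
  have hM0 : 0 ≤ M := (Real.rpow_nonneg (integral_nonneg fun x =>
    Real.rpow_nonneg (le_max_left _ _) _) _).trans (hM 0 h0T)
  exact Torus.classicalNS_continuation_of_posPart_tripleProduct_rpow_integral_le e hν hT hs h hmean
    hw (N := fun _ => M) continuousOn_const (fun _ _ => hM0) hM (I := M ^ (2 * s / (s - 3)) * T)
    fun _ ht => ChaeLee2017.integral_const_rpow_le hM0 ht

/-- **Thm 1 (ii) at `β = 2` on `T³`, printed form, face (C): `γ = ∞`, `2 ≤ α < ∞`** —
`κ(t, x) ≤ N(t)` for all `x` (`κ = {(u × ω/|ω|)·(−Δu/|Δu|)}₊` in the frame `e`), `N ≥ 0`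
continuous with `∫₀ᵗ N^α ≤ I` on `[0, T)` ⇒ continuation past `T`. The endpoint `α = 2`:
`Torus.classicalNS_continuation_of_posPart_tripleProduct_sup_sq_integral_le`.
[cite: ChaeLee2017, Thm 1 (ii) (β = 2, γ = ∞, 2 ≤ α < ∞; proof §2)] -/
theorem Torus.classicalNS_continuation_of_posPart_tripleProduct_sup_rpow_integral_le
    (e : d ≃ Fin 3) {a : ℝ} (hν : 0 < ν) (hT : 0 < T) (ha : 2 ≤ a)
    (h : Torus.IsClassicalNSSolutionOn (Ico 0 T) ν 0 u p)
    (hmean : ∀ t ∈ Ico 0 T, Torus.HasZeroMean (u t)) {w : ℝ → d → UnitAddTorus d → ℝ}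
    (hw : ∀ t k x, w t k x = torusVorticityTensor (u t) (e.symm (e k + 1)) (e.symm (e k + 2)) x)
    {N : ℝ → ℝ} (hNc : ContinuousOn N (Ico 0 T)) (hN0 : ∀ t ∈ Ico 0 T, 0 ≤ N t)
    (hN : ∀ t ∈ Ico 0 T, ∀ x, max 0 ((∑ k, (u t x (e.symm (e k + 1)) * w t (e.symm (e k + 2)) x -
          u t x (e.symm (e k + 2)) * w t (e.symm (e k + 1)) x) * (-Torus.laplacian (u t) x k)) /
          (Real.sqrt (∑ k, w t k x ^ 2) * ‖Torus.laplacian (u t) x‖)) ≤ N t)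
    {I : ℝ} (hI : ∀ t ∈ Ico 0 T, ∫ τ in (0 : ℝ)..t, N τ ^ a ≤ I) :
    ∃ T' : ℝ, T < T' ∧ ∃ (u' : ℝ → UnitAddTorus d → EuclideanSpace ℝ d)
      (p' : ℝ → UnitAddTorus d → ℝ), Torus.IsClassicalNSSolutionOn (Icc 0 T') ν 0 u' p' ∧
        (∀ t ∈ Icc 0 T', Torus.HasZeroMean (u' t)) ∧ ∀ t ∈ Ico 0 T, u' t = u t :=
  Torus.classicalNS_continuation_of_posPart_tripleProduct_sup_sq_integral_le e hν hT h hmean hw hNc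
    hN0 hN (I := 2 / a * I + (1 - 2 / a) * T)
    fun _ ht => ChaeLee2017.integral_sq_le_of_exponent ha hNc hN0 hI ht

/-- **Thm 1 (ii) at `β = 2` on `T³`, printed form, face (D): `γ = α = ∞`** — the factor is
bounded, `κ(t, x) ≤ M` on `[0, T) × T^d` (`κ = {(u × ω/|ω|)·(−Δu/|Δu|)}₊` in the frame `e`; then
`M ≥ 0` automatically) ⇒ continuation past `T`.
[cite: ChaeLee2017, Thm 1 (ii) (β = 2, γ = α = ∞; proof §2)] -/
theorem Torus.classicalNS_continuation_of_posPart_tripleProduct_sup_le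
    (e : d ≃ Fin 3) (hν : 0 < ν) (hT : 0 < T)
    (h : Torus.IsClassicalNSSolutionOn (Ico 0 T) ν 0 u p)
    (hmean : ∀ t ∈ Ico 0 T, Torus.HasZeroMean (u t)) {w : ℝ → d → UnitAddTorus d → ℝ}
    (hw : ∀ t k x, w t k x = torusVorticityTensor (u t) (e.symm (e k + 1)) (e.symm (e k + 2)) x)
    {M : ℝ}
    (hM : ∀ t ∈ Ico 0 T, ∀ x, max 0 ((∑ k, (u t x (e.symm (e k + 1)) * w t (e.symm (e k + 2)) x -
          u t x (e.symm (e k + 2)) * w t (e.symm (e k + 1)) x) * (-Torus.laplacian (u t) x k)) /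
          (Real.sqrt (∑ k, w t k x ^ 2) * ‖Torus.laplacian (u t) x‖)) ≤ M) :
    ∃ T' : ℝ, T < T' ∧ ∃ (u' : ℝ → UnitAddTorus d → EuclideanSpace ℝ d)
      (p' : ℝ → UnitAddTorus d → ℝ), Torus.IsClassicalNSSolutionOn (Icc 0 T') ν 0 u' p' ∧
        (∀ t ∈ Icc 0 T', Torus.HasZeroMean (u' t)) ∧ ∀ t ∈ Ico 0 T, u' t = u t := by
  have hM0 : 0 ≤ M := (le_max_left _ _).trans (hM 0 ⟨le_rfl, hT⟩ 0)
  exact Torus.classicalNS_continuation_of_posPart_tripleProduct_sup_sq_integral_le e hν hT h hmean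
    hw (N := fun _ => M) continuousOn_const (fun _ _ => hM0) hM (I := M ^ 2 * T)
    fun _ ht => ChaeLee2017.integral_const_sq_le ht

/-- **The blow-up reading of Thm 1 (ii) (`β = 2`) on face (A) of the printed range.** If `T` IS a
blow-up time of the classical mean-zero solution (`‖∇u(t)‖₂` unbounded on `[0, T)`), then for all
`3 < γ < ∞`, `2 ≤ α < ∞` with `3/γ + 2/α ≤ 1` and every continuous majorant
`N ≥ (∫κ(t)^γ)^{1/γ}` the primitive `∫₀ᵗ N^α` is unbounded on `[0, T)`
("`‖{…}₊‖_{L^{γ,α}(Q_{T_*})} = ∞`"); via the tree's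
`Torus.classicalNS_not_continuation_of_not_bddAbove_gradNormSq'`.
[cite: ChaeLee2017, Thm 1 (ii) (β = 2, 3 < γ < ∞, 2 ≤ α < ∞, 3/γ + 2/α ≤ 1)] -/
theorem Torus.forall_exists_lt_integral_posPartMajorant_of_not_bddAbove_gradNormSq_of_exponents
    (e : d ≃ Fin 3) {s a : ℝ} (hν : 0 < ν) (hT : 0 < T) (hs : 3 < s) (ha : 2 ≤ a)
    (hsa : 3 / s + 2 / a ≤ 1)
    (h : Torus.IsClassicalNSSolutionOn (Ico 0 T) ν 0 u p)
    (hmean : ∀ t ∈ Ico 0 T, Torus.HasZeroMean (u t)) {w : ℝ → d → UnitAddTorus d → ℝ}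
    (hw : ∀ t k x, w t k x = torusVorticityTensor (u t) (e.symm (e k + 1)) (e.symm (e k + 2)) x)
    {N : ℝ → ℝ} (hNc : ContinuousOn N (Ico 0 T)) (hN0 : ∀ t ∈ Ico 0 T, 0 ≤ N t)
    (hN : ∀ t ∈ Ico 0 T, (∫ x, (max 0 ((∑ k, (u t x (e.symm (e k + 1)) * w t (e.symm (e k + 2)) x -
          u t x (e.symm (e k + 2)) * w t (e.symm (e k + 1)) x) * (-Torus.laplacian (u t) x k)) /
          (Real.sqrt (∑ k, w t k x ^ 2) * ‖Torus.laplacian (u t) x‖))) ^ s) ^ (1 / s) ≤ N t)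
    (hbu : ¬BddAbove ((fun t => Torus.gradNormSq (u t)) '' Ico 0 T)) :
    ∀ I : ℝ, ∃ t ∈ Ico 0 T, I < ∫ τ in (0 : ℝ)..t, N τ ^ a := by
  intro I
  by_contra hcon
  push Not at hcon
  exact Torus.classicalNS_not_continuation_of_not_bddAbove_gradNormSq' hν.le hT h hbu
    (Torus.classicalNS_continuation_of_posPart_tripleProduct_rpow_integral_le_of_exponents e hν hT
      hs ha hsa h hmean hw hNc hN0 hN hcon)

/-- **The blow-up reading of Thm 1 (ii) (`β = 2`) on face (B): `α = ∞`.** If `T` IS a blow-up time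
of the classical mean-zero solution, then for every `3 < γ < ∞` the norms `‖κ(t)‖_{L^γ}`,
`t ∈ [0, T)`, are unbounded ("`‖{…}₊‖_{L^{γ,∞}(Q_{T_*})} = ∞`").
[cite: ChaeLee2017, Thm 1 (ii) (β = 2, 3 < γ < ∞, α = ∞)] -/
theorem Torus.forall_exists_lt_posPart_tripleProduct_Lp_of_not_bddAbove_gradNormSq
    (e : d ≃ Fin 3) {s : ℝ} (hν : 0 < ν) (hT : 0 < T) (hs : 3 < s)
    (h : Torus.IsClassicalNSSolutionOn (Ico 0 T) ν 0 u p)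
    (hmean : ∀ t ∈ Ico 0 T, Torus.HasZeroMean (u t)) {w : ℝ → d → UnitAddTorus d → ℝ}
    (hw : ∀ t k x, w t k x = torusVorticityTensor (u t) (e.symm (e k + 1)) (e.symm (e k + 2)) x)
    (hbu : ¬BddAbove ((fun t => Torus.gradNormSq (u t)) '' Ico 0 T)) :
    ∀ M : ℝ, ∃ t ∈ Ico 0 T,
      M < (∫ x, (max 0 ((∑ k, (u t x (e.symm (e k + 1)) * w t (e.symm (e k + 2)) x -
          u t x (e.symm (e k + 2)) * w t (e.symm (e k + 1)) x) * (-Torus.laplacian (u t) x k)) /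
          (Real.sqrt (∑ k, w t k x ^ 2) * ‖Torus.laplacian (u t) x‖))) ^ s) ^ (1 / s) := by
  intro M
  by_contra hcon
  push Not at hcon
  exact Torus.classicalNS_not_continuation_of_not_bddAbove_gradNormSq' hν.le hT h hbu
    (Torus.classicalNS_continuation_of_posPart_tripleProduct_Lp_le e hν hT hs h hmean hw hcon)

end BetaTwoPrinted

/-! ### §4 Levels `1 < β < 2`: depletion-factor form (the parents' uniform Grönwall constant) -/

section BetaFracFactor

/-- **Chae–Lee 2017, Thm 1 (ii) at `1 < β < 2` on `T³`, depletion-factor form, face (A) of the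
printed range: `3 < γ < ∞`, `2 ≤ α < ∞`, `3/γ + 2/α ≤ 1` (typed literally).** With the UNIFORM
`K = K(d, β, γ, ν) ≥ 0` of `Torus.classicalNS_continuation_of_lambDepletion_frac_rpow_integral_le`
(quantified before the data): a classical mean-zero solution `(u, p)` of the unforced equations
(`ν > 0`) on `[0, T) × T^d`, `card d = 3`, `T > 0`, with a bounded measurable `κ(t,·) ≥ 0`,
`(u × ω)·Λ^βu ≤ κ|ω||Λ^βu|` pointwise, a continuous `N ≥ 0`, `(∫κ(t)^γ)^{1/γ} ≤ N(t)` and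
`∫₀ᵗ N^α ≤ I` on `[0, T)`, obeys
`X_{β/2}(t) + 4π²ν∫₀ᵗX_{β/2+1} ≤ e^{K((α₀/α) I + (1 − α₀/α) T)} X_{β/2}(0)` on `[0, T)`
(`α₀ = 2γ/(γ−3)`; the `T`-dependence is that of the Young step in time) and continues to a classical
mean-zero solution on some `[0, T'] × T^d`, `T' > T`, equal to `u` on `[0, T)`.
[cite: ChaeLee2017, Thm 1 (ii) (1 < β < 2, 3 < γ < ∞, 2 ≤ α < ∞, 3/γ + 2/α ≤ 1; proof §2)] -/
theorem Torus.classicalNS_continuation_of_lambDepletion_frac_rpow_integral_le_of_exponents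
    (hd : Fintype.card d = 3) {β s a ν : ℝ} (hβ1 : 1 < β) (hβ2 : β < 2) (hs : 3 < s) (ha : 2 ≤ a)
    (hsa : 3 / s + 2 / a ≤ 1) (hν : 0 < ν) :
    ∃ K : ℝ, 0 ≤ K ∧ ∀ {T : ℝ}, 0 < T →
      ∀ {u : ℝ → UnitAddTorus d → EuclideanSpace ℝ d} {p : ℝ → UnitAddTorus d → ℝ},
      Torus.IsClassicalNSSolutionOn (Ico 0 T) ν 0 u p → (∀ t ∈ Ico 0 T, Torus.HasZeroMean (u t)) →
      ∀ {κ : ℝ → UnitAddTorus d → ℝ}, (∀ t ∈ Ico 0 T, AEStronglyMeasurable (κ t) volume) →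
      (∀ t ∈ Ico 0 T, ∀ x, 0 ≤ κ t x) → (∀ t ∈ Ico 0 T, ∃ B : ℝ, ∀ x, κ t x ≤ B) →
      (∀ t ∈ Ico 0 T, ∀ x, ∑ i, ∑ j, u t x j *
          (Torus.partialDeriv i (u t) x j - Torus.partialDeriv j (u t) x i) *
          Torus.fracLaplacian (β / 2) (u t) x i ≤
        κ t x * Real.sqrt (torusVorticitySqAt (u t) x) *
          ‖Torus.fracLaplacian (β / 2) (u t) x‖) →
      ∀ {N : ℝ → ℝ}, ContinuousOn N (Ico 0 T) → (∀ t ∈ Ico 0 T, 0 ≤ N t) →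
      (∀ t ∈ Ico 0 T, (∫ x, κ t x ^ s) ^ (1 / s) ≤ N t) →
      ∀ {I : ℝ}, (∀ t ∈ Ico 0 T, ∫ τ in (0 : ℝ)..t, N τ ^ a ≤ I) →
      (∀ t ∈ Ico 0 T, (∑' k : d → ℤ, freqNormSq k ^ (β / 2) *
            ‖mFourierCoeff (EuclideanSpace.complexify ∘ u t) k‖ ^ 2) +
          4 * Real.pi ^ 2 * ν * ∫ τ in (0 : ℝ)..t, ∑' k : d → ℤ, freqNormSq k ^ (β / 2 + 1) *
            ‖mFourierCoeff (EuclideanSpace.complexify ∘ u τ) k‖ ^ 2 ≤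
        Real.exp (K * ((2 * s / (s - 3)) / a * I + (1 - (2 * s / (s - 3)) / a) * T)) *
          ∑' k : d → ℤ, freqNormSq k ^ (β / 2) *
            ‖mFourierCoeff (EuclideanSpace.complexify ∘ u 0) k‖ ^ 2) ∧
      ∃ T' : ℝ, T < T' ∧ ∃ (u' : ℝ → UnitAddTorus d → EuclideanSpace ℝ d)
        (p' : ℝ → UnitAddTorus d → ℝ), Torus.IsClassicalNSSolutionOn (Icc 0 T') ν 0 u' p' ∧
          (∀ t ∈ Icc 0 T', Torus.HasZeroMean (u' t)) ∧ ∀ t ∈ Ico 0 T, u' t = u t := by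
  obtain ⟨K, hK0, H⟩ :=
    Torus.classicalNS_continuation_of_lambDepletion_frac_rpow_integral_le (d := d) hd hβ1 hβ2 hs hν
  refine ⟨K, hK0, fun {T} hT {u p} h hmean {κ} hκm hκ0 hκB hdep {N} hNc hN0 hN {I} hI => ?_⟩
  exact H hT h hmean hκm hκ0 hκB hdep hNc hN0 hN
    (I := (2 * s / (s - 3)) / a * I + (1 - (2 * s / (s - 3)) / a) * T)
    fun _ ht => ChaeLee2017.integral_rpow_crit_le_of_exponents hs ha hsa hNc hN0 hI ht

/-- **Face (B) at `1 < β < 2`, depletion-factor form: `3 < γ < ∞`, `α = ∞`** — with the same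
uniform `K`: `(∫κ(t)^γ)^{1/γ} ≤ M` for all `t ∈ [0, T)` ⇒
`X_{β/2}(t) + 4π²ν∫₀ᵗX_{β/2+1} ≤ e^{K M^{2γ/(γ−3)} T} X_{β/2}(0)` on `[0, T)` and continuation
past `T`.
[cite: ChaeLee2017, Thm 1 (ii) (1 < β < 2, 3 < γ < ∞, α = ∞; proof §2)] -/
theorem Torus.classicalNS_continuation_of_lambDepletion_frac_Lp_le
    (hd : Fintype.card d = 3) {β s ν : ℝ} (hβ1 : 1 < β) (hβ2 : β < 2) (hs : 3 < s) (hν : 0 < ν) :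
    ∃ K : ℝ, 0 ≤ K ∧ ∀ {T : ℝ}, 0 < T →
      ∀ {u : ℝ → UnitAddTorus d → EuclideanSpace ℝ d} {p : ℝ → UnitAddTorus d → ℝ},
      Torus.IsClassicalNSSolutionOn (Ico 0 T) ν 0 u p → (∀ t ∈ Ico 0 T, Torus.HasZeroMean (u t)) →
      ∀ {κ : ℝ → UnitAddTorus d → ℝ}, (∀ t ∈ Ico 0 T, AEStronglyMeasurable (κ t) volume) →
      (∀ t ∈ Ico 0 T, ∀ x, 0 ≤ κ t x) → (∀ t ∈ Ico 0 T, ∃ B : ℝ, ∀ x, κ t x ≤ B) →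
      (∀ t ∈ Ico 0 T, ∀ x, ∑ i, ∑ j, u t x j *
          (Torus.partialDeriv i (u t) x j - Torus.partialDeriv j (u t) x i) *
          Torus.fracLaplacian (β / 2) (u t) x i ≤
        κ t x * Real.sqrt (torusVorticitySqAt (u t) x) *
          ‖Torus.fracLaplacian (β / 2) (u t) x‖) →
      ∀ {M : ℝ}, (∀ t ∈ Ico 0 T, (∫ x, κ t x ^ s) ^ (1 / s) ≤ M) →
      (∀ t ∈ Ico 0 T, (∑' k : d → ℤ, freqNormSq k ^ (β / 2) *
            ‖mFourierCoeff (EuclideanSpace.complexify ∘ u t) k‖ ^ 2) +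
          4 * Real.pi ^ 2 * ν * ∫ τ in (0 : ℝ)..t, ∑' k : d → ℤ, freqNormSq k ^ (β / 2 + 1) *
            ‖mFourierCoeff (EuclideanSpace.complexify ∘ u τ) k‖ ^ 2 ≤
        Real.exp (K * (M ^ (2 * s / (s - 3)) * T)) *
          ∑' k : d → ℤ, freqNormSq k ^ (β / 2) *
            ‖mFourierCoeff (EuclideanSpace.complexify ∘ u 0) k‖ ^ 2) ∧
      ∃ T' : ℝ, T < T' ∧ ∃ (u' : ℝ → UnitAddTorus d → EuclideanSpace ℝ d)
        (p' : ℝ → UnitAddTorus d → ℝ), Torus.IsClassicalNSSolutionOn (Icc 0 T') ν 0 u' p' ∧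
          (∀ t ∈ Icc 0 T', Torus.HasZeroMean (u' t)) ∧ ∀ t ∈ Ico 0 T, u' t = u t := by
  obtain ⟨K, hK0, H⟩ :=
    Torus.classicalNS_continuation_of_lambDepletion_frac_rpow_integral_le (d := d) hd hβ1 hβ2 hs hν
  refine ⟨K, hK0, fun {T} hT {u p} h hmean {κ} hκm hκ0 hκB hdep {M} hM => ?_⟩
  have h0T : (0 : ℝ) ∈ Ico 0 T := ⟨le_rfl, hT⟩
  have hM0 : 0 ≤ M := (Real.rpow_nonneg (integral_nonneg fun x =>
    Real.rpow_nonneg (hκ0 0 h0T x) _) _).trans (hM 0 h0T)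
  exact H hT h hmean hκm hκ0 hκB hdep (N := fun _ => M) continuousOn_const (fun _ _ => hM0) hM
    (I := M ^ (2 * s / (s - 3)) * T) fun _ ht => ChaeLee2017.integral_const_rpow_le hM0 ht

/-- **Face (C) at `1 < β < 2`, depletion-factor form: `γ = ∞`, `2 ≤ α < ∞`** — `κ(t,·) ≤ N(t)`,
`N ≥ 0` continuous with `∫₀ᵗ N^α ≤ I` on `[0, T)` ⇒
`X_{β/2}(t) + 4π²ν∫₀ᵗX_{β/2+1} ≤ e^{2((2/α)I + (1−2/α)T)/ν} X_{β/2}(0)` on `[0, T)` (EXPLICIT,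
from the parents' `e^{2I/ν}` at `α = 2`) and continuation past `T`.
[cite: ChaeLee2017, Thm 1 (ii) (1 < β < 2, γ = ∞, 2 ≤ α < ∞; proof §2)] -/
theorem Torus.classicalNS_continuation_of_lambDepletion_frac_sup_rpow_integral_le
    (hd : Fintype.card d = 3) {β a : ℝ} (hβ1 : 1 < β) (hβ2 : β < 2) (ha : 2 ≤ a) {ν T : ℝ}
    (hν : 0 < ν) (hT : 0 < T)
    {u : ℝ → UnitAddTorus d → EuclideanSpace ℝ d} {p : ℝ → UnitAddTorus d → ℝ}
    (h : Torus.IsClassicalNSSolutionOn (Ico 0 T) ν 0 u p)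
    (hmean : ∀ t ∈ Ico 0 T, Torus.HasZeroMean (u t)) {κ : ℝ → UnitAddTorus d → ℝ}
    (hdep : ∀ t ∈ Ico 0 T, ∀ x, ∑ i, ∑ j, u t x j *
        (Torus.partialDeriv i (u t) x j - Torus.partialDeriv j (u t) x i) *
        Torus.fracLaplacian (β / 2) (u t) x i ≤
      κ t x * Real.sqrt (torusVorticitySqAt (u t) x) * ‖Torus.fracLaplacian (β / 2) (u t) x‖)
    {N : ℝ → ℝ} (hNc : ContinuousOn N (Ico 0 T)) (hN0 : ∀ t ∈ Ico 0 T, 0 ≤ N t)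
    (hκN : ∀ t ∈ Ico 0 T, ∀ x, κ t x ≤ N t)
    {I : ℝ} (hI : ∀ t ∈ Ico 0 T, ∫ τ in (0 : ℝ)..t, N τ ^ a ≤ I) :
    (∀ t ∈ Ico 0 T, (∑' k : d → ℤ, freqNormSq k ^ (β / 2) *
          ‖mFourierCoeff (EuclideanSpace.complexify ∘ u t) k‖ ^ 2) +
        4 * Real.pi ^ 2 * ν * ∫ τ in (0 : ℝ)..t, ∑' k : d → ℤ, freqNormSq k ^ (β / 2 + 1) *
          ‖mFourierCoeff (EuclideanSpace.complexify ∘ u τ) k‖ ^ 2 ≤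
      Real.exp (2 * (2 / a * I + (1 - 2 / a) * T) / ν) * ∑' k : d → ℤ, freqNormSq k ^ (β / 2) *
          ‖mFourierCoeff (EuclideanSpace.complexify ∘ u 0) k‖ ^ 2) ∧
    ∃ T' : ℝ, T < T' ∧ ∃ (u' : ℝ → UnitAddTorus d → EuclideanSpace ℝ d)
      (p' : ℝ → UnitAddTorus d → ℝ), Torus.IsClassicalNSSolutionOn (Icc 0 T') ν 0 u' p' ∧
        (∀ t ∈ Icc 0 T', Torus.HasZeroMean (u' t)) ∧ ∀ t ∈ Ico 0 T, u' t = u t :=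
  Torus.classicalNS_continuation_of_lambDepletion_frac_sup_sq_integral_le hd hβ1 hβ2 hν hT h hmean
    hdep hNc hN0 hκN (I := 2 / a * I + (1 - 2 / a) * T)
    fun _ ht => ChaeLee2017.integral_sq_le_of_exponent ha hNc hN0 hI ht

/-- **Face (D) at `1 < β < 2`, depletion-factor form: `γ = α = ∞`** — `κ ≤ M` on
`[0, T) × T^d`, `M ≥ 0` ⇒ `X_{β/2}(t) + 4π²ν∫₀ᵗX_{β/2+1} ≤ e^{2M²T/ν} X_{β/2}(0)` on `[0, T)`
(EXPLICIT) and continuation past `T`.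
[cite: ChaeLee2017, Thm 1 (ii) (1 < β < 2, γ = α = ∞; proof §2)] -/
theorem Torus.classicalNS_continuation_of_lambDepletion_frac_sup_le
    (hd : Fintype.card d = 3) {β : ℝ} (hβ1 : 1 < β) (hβ2 : β < 2) {ν T : ℝ} (hν : 0 < ν)
    (hT : 0 < T)
    {u : ℝ → UnitAddTorus d → EuclideanSpace ℝ d} {p : ℝ → UnitAddTorus d → ℝ}
    (h : Torus.IsClassicalNSSolutionOn (Ico 0 T) ν 0 u p)
    (hmean : ∀ t ∈ Ico 0 T, Torus.HasZeroMean (u t)) {κ : ℝ → UnitAddTorus d → ℝ}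
    (hdep : ∀ t ∈ Ico 0 T, ∀ x, ∑ i, ∑ j, u t x j *
        (Torus.partialDeriv i (u t) x j - Torus.partialDeriv j (u t) x i) *
        Torus.fracLaplacian (β / 2) (u t) x i ≤
      κ t x * Real.sqrt (torusVorticitySqAt (u t) x) * ‖Torus.fracLaplacian (β / 2) (u t) x‖)
    {M : ℝ} (hM0 : 0 ≤ M) (hκM : ∀ t ∈ Ico 0 T, ∀ x, κ t x ≤ M) :
    (∀ t ∈ Ico 0 T, (∑' k : d → ℤ, freqNormSq k ^ (β / 2) *
          ‖mFourierCoeff (EuclideanSpace.complexify ∘ u t) k‖ ^ 2) +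
        4 * Real.pi ^ 2 * ν * ∫ τ in (0 : ℝ)..t, ∑' k : d → ℤ, freqNormSq k ^ (β / 2 + 1) *
          ‖mFourierCoeff (EuclideanSpace.complexify ∘ u τ) k‖ ^ 2 ≤
      Real.exp (2 * (M ^ 2 * T) / ν) * ∑' k : d → ℤ, freqNormSq k ^ (β / 2) *
          ‖mFourierCoeff (EuclideanSpace.complexify ∘ u 0) k‖ ^ 2) ∧
    ∃ T' : ℝ, T < T' ∧ ∃ (u' : ℝ → UnitAddTorus d → EuclideanSpace ℝ d)
      (p' : ℝ → UnitAddTorus d → ℝ), Torus.IsClassicalNSSolutionOn (Icc 0 T') ν 0 u' p' ∧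
        (∀ t ∈ Icc 0 T', Torus.HasZeroMean (u' t)) ∧ ∀ t ∈ Ico 0 T, u' t = u t :=
  Torus.classicalNS_continuation_of_lambDepletion_frac_sup_sq_integral_le hd hβ1 hβ2 hν hT h hmean
    hdep (N := fun _ => M) continuousOn_const (fun _ _ => hM0) hκM (I := M ^ 2 * T)
    fun _ ht => ChaeLee2017.integral_const_sq_le ht

end BetaFracFactor

/-! ### §5 Levels `1 < β < 2`: the printed factor `{(u × ω/|ω|)·(Λ^βu/|Λ^βu|)}₊` in a frame -/

section BetaFracPrinted

/-- **Chae–Lee 2017, Thm 1 (ii) at `1 < β < 2` on `T³` — the printed form on face (A) of the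
printed range: `3 < γ < ∞`, `2 ≤ α < ∞`, `3/γ + 2/α ≤ 1` (typed literally).** On the unit torus
(`card d = 3` via a frame `e`, `k⁺ = e⁻¹(e k + 1)`, `k⁺⁺ = e⁻¹(e k + 2)`,
`ωₖ = (∂_{k⁺}u)_{k⁺⁺} − (∂_{k⁺⁺}u)_{k⁺}`, `κ(t,x) := max{0, ∑ₖ(u × ω)ₖ(Λ^βu)ₖ/(|ω||Λ^βu|)}`,
`Λ^β = (−Δ)^{β/2}`), with the UNIFORM `K = K(d, β, γ, ν) ≥ 0` of the parent (before the data): a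
classical mean-zero solution of the unforced equations (`ν > 0`) on `[0, T) × T^d`, `T > 0`, with a
continuous `N ≥ 0`, `(∫κ(t)^γ)^{1/γ} ≤ N(t)`, `∫₀ᵗ N^α ≤ I` on `[0, T)`, obeys
`X_{β/2}(t) + 4π²ν∫₀ᵗX_{β/2+1} ≤ e^{K((α₀/α)I + (1−α₀/α)T)} X_{β/2}(0)` (`α₀ = 2γ/(γ−3)`) and
continues to a classical mean-zero solution on some `[0, T'] × T^d`, `T' > T`, equal to `u` on
`[0, T)` — `T` is not a blow-up time. The line `3/γ + 2/α = 1`: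
`Torus.classicalNS_continuation_of_posPart_tripleProduct_frac_rpow_integral_le`.
[cite: ChaeLee2017, Thm 1 (ii) (1 < β < 2, 3 < γ < ∞, 2 ≤ α < ∞, 3/γ + 2/α ≤ 1; proof §2)] -/
theorem Torus.classicalNS_continuation_of_posPart_tripleProduct_frac_rpow_integral_le_of_exponents
    (e : d ≃ Fin 3) {β s a ν : ℝ} (hβ1 : 1 < β) (hβ2 : β < 2) (hs : 3 < s) (ha : 2 ≤ a)
    (hsa : 3 / s + 2 / a ≤ 1) (hν : 0 < ν) :
    ∃ K : ℝ, 0 ≤ K ∧ ∀ {T : ℝ}, 0 < T →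
      ∀ {u : ℝ → UnitAddTorus d → EuclideanSpace ℝ d} {p : ℝ → UnitAddTorus d → ℝ},
      Torus.IsClassicalNSSolutionOn (Ico 0 T) ν 0 u p → (∀ t ∈ Ico 0 T, Torus.HasZeroMean (u t)) →
      ∀ {w : ℝ → d → UnitAddTorus d → ℝ},
      (∀ t k x, w t k x = Torus.partialDeriv (e.symm (e k + 1)) (u t) x (e.symm (e k + 2)) -
        Torus.partialDeriv (e.symm (e k + 2)) (u t) x (e.symm (e k + 1))) →
      ∀ {N : ℝ → ℝ}, ContinuousOn N (Ico 0 T) → (∀ t ∈ Ico 0 T, 0 ≤ N t) →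
      (∀ t ∈ Ico 0 T, (∫ x, (max 0 ((∑ k, (u t x (e.symm (e k + 1)) * w t (e.symm (e k + 2)) x -
        u t x (e.symm (e k + 2)) * w t (e.symm (e k + 1)) x) *
        Torus.fracLaplacian (β / 2) (u t) x k) /
        (Real.sqrt (∑ k, w t k x ^ 2) * ‖Torus.fracLaplacian (β / 2) (u t) x‖))) ^ s) ^
        (1 / s) ≤ N t) →
      ∀ {I : ℝ}, (∀ t ∈ Ico 0 T, ∫ τ in (0 : ℝ)..t, N τ ^ a ≤ I) →
      (∀ t ∈ Ico 0 T, (∑' k : d → ℤ, freqNormSq k ^ (β / 2) *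
            ‖mFourierCoeff (EuclideanSpace.complexify ∘ u t) k‖ ^ 2) +
          4 * Real.pi ^ 2 * ν * ∫ τ in (0 : ℝ)..t, ∑' k : d → ℤ, freqNormSq k ^ (β / 2 + 1) *
            ‖mFourierCoeff (EuclideanSpace.complexify ∘ u τ) k‖ ^ 2 ≤
        Real.exp (K * ((2 * s / (s - 3)) / a * I + (1 - (2 * s / (s - 3)) / a) * T)) *
          ∑' k : d → ℤ, freqNormSq k ^ (β / 2) *
            ‖mFourierCoeff (EuclideanSpace.complexify ∘ u 0) k‖ ^ 2) ∧
      ∃ T' : ℝ, T < T' ∧ ∃ (u' : ℝ → UnitAddTorus d → EuclideanSpace ℝ d)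
        (p' : ℝ → UnitAddTorus d → ℝ), Torus.IsClassicalNSSolutionOn (Icc 0 T') ν 0 u' p' ∧
          (∀ t ∈ Icc 0 T', Torus.HasZeroMean (u' t)) ∧ ∀ t ∈ Ico 0 T, u' t = u t := by
  obtain ⟨K, hK0, H⟩ :=
    Torus.classicalNS_continuation_of_posPart_tripleProduct_frac_rpow_integral_le e hβ1 hβ2 hs hν
  refine ⟨K, hK0, fun {T} hT {u p} h hmean {w} hw {N} hNc hN0 hN {I} hI => ?_⟩
  exact H hT h hmean hw hNc hN0 hN
    (I := (2 * s / (s - 3)) / a * I + (1 - (2 * s / (s - 3)) / a) * T)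
    fun _ ht => ChaeLee2017.integral_rpow_crit_le_of_exponents hs ha hsa hNc hN0 hI ht

/-- **Thm 1 (ii) at `1 < β < 2` on `T³`, printed form, face (B): `3 < γ < ∞`, `α = ∞`** — with the
same uniform `K`: `‖κ(t)‖_{L^γ} ≤ M` for all `t ∈ [0, T)` (`κ` the printed factor in the frame `e`)
⇒ `X_{β/2}(t) + 4π²ν∫₀ᵗX_{β/2+1} ≤ e^{K M^{2γ/(γ−3)} T} X_{β/2}(0)` on `[0, T)` and continuation
past `T`.
[cite: ChaeLee2017, Thm 1 (ii) (1 < β < 2, 3 < γ < ∞, α = ∞; proof §2)] -/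
theorem Torus.classicalNS_continuation_of_posPart_tripleProduct_frac_Lp_le
    (e : d ≃ Fin 3) {β s ν : ℝ} (hβ1 : 1 < β) (hβ2 : β < 2) (hs : 3 < s) (hν : 0 < ν) :
    ∃ K : ℝ, 0 ≤ K ∧ ∀ {T : ℝ}, 0 < T →
      ∀ {u : ℝ → UnitAddTorus d → EuclideanSpace ℝ d} {p : ℝ → UnitAddTorus d → ℝ},
      Torus.IsClassicalNSSolutionOn (Ico 0 T) ν 0 u p → (∀ t ∈ Ico 0 T, Torus.HasZeroMean (u t)) →
      ∀ {w : ℝ → d → UnitAddTorus d → ℝ},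
      (∀ t k x, w t k x = Torus.partialDeriv (e.symm (e k + 1)) (u t) x (e.symm (e k + 2)) -
        Torus.partialDeriv (e.symm (e k + 2)) (u t) x (e.symm (e k + 1))) →
      ∀ {M : ℝ},
      (∀ t ∈ Ico 0 T, (∫ x, (max 0 ((∑ k, (u t x (e.symm (e k + 1)) * w t (e.symm (e k + 2)) x -
        u t x (e.symm (e k + 2)) * w t (e.symm (e k + 1)) x) *
        Torus.fracLaplacian (β / 2) (u t) x k) /
        (Real.sqrt (∑ k, w t k x ^ 2) * ‖Torus.fracLaplacian (β / 2) (u t) x‖))) ^ s) ^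
        (1 / s) ≤ M) →
      (∀ t ∈ Ico 0 T, (∑' k : d → ℤ, freqNormSq k ^ (β / 2) *
            ‖mFourierCoeff (EuclideanSpace.complexify ∘ u t) k‖ ^ 2) +
          4 * Real.pi ^ 2 * ν * ∫ τ in (0 : ℝ)..t, ∑' k : d → ℤ, freqNormSq k ^ (β / 2 + 1) *
            ‖mFourierCoeff (EuclideanSpace.complexify ∘ u τ) k‖ ^ 2 ≤
        Real.exp (K * (M ^ (2 * s / (s - 3)) * T)) *
          ∑' k : d → ℤ, freqNormSq k ^ (β / 2) *
            ‖mFourierCoeff (EuclideanSpace.complexify ∘ u 0) k‖ ^ 2) ∧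
      ∃ T' : ℝ, T < T' ∧ ∃ (u' : ℝ → UnitAddTorus d → EuclideanSpace ℝ d)
        (p' : ℝ → UnitAddTorus d → ℝ), Torus.IsClassicalNSSolutionOn (Icc 0 T') ν 0 u' p' ∧
          (∀ t ∈ Icc 0 T', Torus.HasZeroMean (u' t)) ∧ ∀ t ∈ Ico 0 T, u' t = u t := by
  obtain ⟨K, hK0, H⟩ :=
    Torus.classicalNS_continuation_of_posPart_tripleProduct_frac_rpow_integral_le e hβ1 hβ2 hs hν
  refine ⟨K, hK0, fun {T} hT {u p} h hmean {w} hw {M} hM => ?_⟩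
  have h0T : (0 : ℝ) ∈ Ico 0 T := ⟨le_rfl, hT⟩
  have hM0 : 0 ≤ M := (Real.rpow_nonneg (integral_nonneg fun x =>
    Real.rpow_nonneg (le_max_left _ _) _) _).trans (hM 0 h0T)
  exact H hT h hmean hw (N := fun _ => M) continuousOn_const (fun _ _ => hM0) hM
    (I := M ^ (2 * s / (s - 3)) * T) fun _ ht => ChaeLee2017.integral_const_rpow_le hM0 ht

/-- **Thm 1 (ii) at `1 < β < 2` on `T³`, printed form, face (C): `γ = ∞`, `2 ≤ α < ∞`** —
`κ(t, x) ≤ N(t)` for all `x` (`κ` the printed factor in the frame `e`), `N ≥ 0` continuous with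
`∫₀ᵗ N^α ≤ I` on `[0, T)` ⇒
`X_{β/2}(t) + 4π²ν∫₀ᵗX_{β/2+1} ≤ e^{2((2/α)I + (1−2/α)T)/ν} X_{β/2}(0)` (EXPLICIT) and continuation
past `T`. The endpoint `α = 2`:
`Torus.classicalNS_continuation_of_posPart_tripleProduct_frac_sup_sq_integral_le`.
[cite: ChaeLee2017, Thm 1 (ii) (1 < β < 2, γ = ∞, 2 ≤ α < ∞; proof §2)] -/
theorem Torus.classicalNS_continuation_of_posPart_tripleProduct_frac_sup_rpow_integral_le
    (e : d ≃ Fin 3) {β a : ℝ} (hβ1 : 1 < β) (hβ2 : β < 2) (ha : 2 ≤ a) {ν T : ℝ} (hν : 0 < ν)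
    (hT : 0 < T)
    {u : ℝ → UnitAddTorus d → EuclideanSpace ℝ d} {p : ℝ → UnitAddTorus d → ℝ}
    (h : Torus.IsClassicalNSSolutionOn (Ico 0 T) ν 0 u p)
    (hmean : ∀ t ∈ Ico 0 T, Torus.HasZeroMean (u t)) {w : ℝ → d → UnitAddTorus d → ℝ}
    (hw : ∀ t k x, w t k x = Torus.partialDeriv (e.symm (e k + 1)) (u t) x (e.symm (e k + 2)) -
      Torus.partialDeriv (e.symm (e k + 2)) (u t) x (e.symm (e k + 1)))
    {N : ℝ → ℝ} (hNc : ContinuousOn N (Ico 0 T)) (hN0 : ∀ t ∈ Ico 0 T, 0 ≤ N t)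
    (hN : ∀ t ∈ Ico 0 T, ∀ x, max 0 ((∑ k, (u t x (e.symm (e k + 1)) * w t (e.symm (e k + 2)) x -
        u t x (e.symm (e k + 2)) * w t (e.symm (e k + 1)) x) *
        Torus.fracLaplacian (β / 2) (u t) x k) /
        (Real.sqrt (∑ k, w t k x ^ 2) * ‖Torus.fracLaplacian (β / 2) (u t) x‖)) ≤ N t)
    {I : ℝ} (hI : ∀ t ∈ Ico 0 T, ∫ τ in (0 : ℝ)..t, N τ ^ a ≤ I) :
    (∀ t ∈ Ico 0 T, (∑' k : d → ℤ, freqNormSq k ^ (β / 2) *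
          ‖mFourierCoeff (EuclideanSpace.complexify ∘ u t) k‖ ^ 2) +
        4 * Real.pi ^ 2 * ν * ∫ τ in (0 : ℝ)..t, ∑' k : d → ℤ, freqNormSq k ^ (β / 2 + 1) *
          ‖mFourierCoeff (EuclideanSpace.complexify ∘ u τ) k‖ ^ 2 ≤
      Real.exp (2 * (2 / a * I + (1 - 2 / a) * T) / ν) * ∑' k : d → ℤ, freqNormSq k ^ (β / 2) *
          ‖mFourierCoeff (EuclideanSpace.complexify ∘ u 0) k‖ ^ 2) ∧
    ∃ T' : ℝ, T < T' ∧ ∃ (u' : ℝ → UnitAddTorus d → EuclideanSpace ℝ d)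
      (p' : ℝ → UnitAddTorus d → ℝ), Torus.IsClassicalNSSolutionOn (Icc 0 T') ν 0 u' p' ∧
        (∀ t ∈ Icc 0 T', Torus.HasZeroMean (u' t)) ∧ ∀ t ∈ Ico 0 T, u' t = u t :=
  Torus.classicalNS_continuation_of_posPart_tripleProduct_frac_sup_sq_integral_le e hβ1 hβ2 hν hT h
    hmean hw hNc hN0 hN (I := 2 / a * I + (1 - 2 / a) * T)
    fun _ ht => ChaeLee2017.integral_sq_le_of_exponent ha hNc hN0 hI ht

/-- **Thm 1 (ii) at `1 < β < 2` on `T³`, printed form, face (D): `γ = α = ∞`** — the printed factor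
is bounded, `κ(t, x) ≤ M` on `[0, T) × T^d` (then `M ≥ 0` automatically) ⇒
`X_{β/2}(t) + 4π²ν∫₀ᵗX_{β/2+1} ≤ e^{2M²T/ν} X_{β/2}(0)` (EXPLICIT) and continuation past `T`.
[cite: ChaeLee2017, Thm 1 (ii) (1 < β < 2, γ = α = ∞; proof §2)] -/
theorem Torus.classicalNS_continuation_of_posPart_tripleProduct_frac_sup_le
    (e : d ≃ Fin 3) {β : ℝ} (hβ1 : 1 < β) (hβ2 : β < 2) {ν T : ℝ} (hν : 0 < ν) (hT : 0 < T)
    {u : ℝ → UnitAddTorus d → EuclideanSpace ℝ d} {p : ℝ → UnitAddTorus d → ℝ}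
    (h : Torus.IsClassicalNSSolutionOn (Ico 0 T) ν 0 u p)
    (hmean : ∀ t ∈ Ico 0 T, Torus.HasZeroMean (u t)) {w : ℝ → d → UnitAddTorus d → ℝ}
    (hw : ∀ t k x, w t k x = Torus.partialDeriv (e.symm (e k + 1)) (u t) x (e.symm (e k + 2)) -
      Torus.partialDeriv (e.symm (e k + 2)) (u t) x (e.symm (e k + 1)))
    {M : ℝ}
    (hM : ∀ t ∈ Ico 0 T, ∀ x, max 0 ((∑ k, (u t x (e.symm (e k + 1)) * w t (e.symm (e k + 2)) x -
        u t x (e.symm (e k + 2)) * w t (e.symm (e k + 1)) x) *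
        Torus.fracLaplacian (β / 2) (u t) x k) /
        (Real.sqrt (∑ k, w t k x ^ 2) * ‖Torus.fracLaplacian (β / 2) (u t) x‖)) ≤ M) :
    (∀ t ∈ Ico 0 T, (∑' k : d → ℤ, freqNormSq k ^ (β / 2) *
          ‖mFourierCoeff (EuclideanSpace.complexify ∘ u t) k‖ ^ 2) +
        4 * Real.pi ^ 2 * ν * ∫ τ in (0 : ℝ)..t, ∑' k : d → ℤ, freqNormSq k ^ (β / 2 + 1) *
          ‖mFourierCoeff (EuclideanSpace.complexify ∘ u τ) k‖ ^ 2 ≤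
      Real.exp (2 * (M ^ 2 * T) / ν) * ∑' k : d → ℤ, freqNormSq k ^ (β / 2) *
          ‖mFourierCoeff (EuclideanSpace.complexify ∘ u 0) k‖ ^ 2) ∧
    ∃ T' : ℝ, T < T' ∧ ∃ (u' : ℝ → UnitAddTorus d → EuclideanSpace ℝ d)
      (p' : ℝ → UnitAddTorus d → ℝ), Torus.IsClassicalNSSolutionOn (Icc 0 T') ν 0 u' p' ∧
        (∀ t ∈ Icc 0 T', Torus.HasZeroMean (u' t)) ∧ ∀ t ∈ Ico 0 T, u' t = u t := by
  have hM0 : 0 ≤ M := (le_max_left _ _).trans (hM 0 ⟨le_rfl, hT⟩ 0)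
  exact Torus.classicalNS_continuation_of_posPart_tripleProduct_frac_sup_sq_integral_le e hβ1 hβ2 hν
    hT h hmean hw (N := fun _ => M) continuousOn_const (fun _ _ => hM0) hM (I := M ^ 2 * T)
    fun _ ht => ChaeLee2017.integral_const_sq_le ht

/-- **The blow-up reading of Thm 1 (ii) at `1 < β < 2` on face (A) of the printed range.** If `T` IS
a blow-up time of the classical mean-zero solution (`‖∇u(t)‖₂` unbounded on `[0, T)`), then for all
`3 < γ < ∞`, `2 ≤ α < ∞` with `3/γ + 2/α ≤ 1` and every continuous majorant
`N ≥ (∫κ(t)^γ)^{1/γ}` (`κ` the printed factor in the frame `e`) the primitive `∫₀ᵗ N^α` is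
unbounded on `[0, T)` ("`‖{…}₊‖_{L^{γ,α}(Q_{T_*})} = ∞`").
[cite: ChaeLee2017, Thm 1 (ii) (1 < β < 2, 3 < γ < ∞, 2 ≤ α < ∞, 3/γ + 2/α ≤ 1)] -/
theorem Torus.forall_exists_lt_integral_posPartMajorant_frac_of_not_bddAbove_gradNormSq_of_exponents
    (e : d ≃ Fin 3) {β s a : ℝ} (hβ1 : 1 < β) (hβ2 : β < 2) (hs : 3 < s) (ha : 2 ≤ a)
    (hsa : 3 / s + 2 / a ≤ 1) {ν T : ℝ} (hν : 0 < ν) (hT : 0 < T)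
    {u : ℝ → UnitAddTorus d → EuclideanSpace ℝ d} {p : ℝ → UnitAddTorus d → ℝ}
    (h : Torus.IsClassicalNSSolutionOn (Ico 0 T) ν 0 u p)
    (hmean : ∀ t ∈ Ico 0 T, Torus.HasZeroMean (u t)) {w : ℝ → d → UnitAddTorus d → ℝ}
    (hw : ∀ t k x, w t k x = Torus.partialDeriv (e.symm (e k + 1)) (u t) x (e.symm (e k + 2)) -
      Torus.partialDeriv (e.symm (e k + 2)) (u t) x (e.symm (e k + 1)))
    {N : ℝ → ℝ} (hNc : ContinuousOn N (Ico 0 T)) (hN0 : ∀ t ∈ Ico 0 T, 0 ≤ N t)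
    (hN : ∀ t ∈ Ico 0 T, (∫ x, (max 0 ((∑ k, (u t x (e.symm (e k + 1)) * w t (e.symm (e k + 2)) x -
        u t x (e.symm (e k + 2)) * w t (e.symm (e k + 1)) x) *
        Torus.fracLaplacian (β / 2) (u t) x k) /
        (Real.sqrt (∑ k, w t k x ^ 2) * ‖Torus.fracLaplacian (β / 2) (u t) x‖))) ^ s) ^
        (1 / s) ≤ N t)
    (hbu : ¬BddAbove ((fun t => Torus.gradNormSq (u t)) '' Ico 0 T)) :
    ∀ I : ℝ, ∃ t ∈ Ico 0 T, I < ∫ τ in (0 : ℝ)..t, N τ ^ a := by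
  obtain ⟨K, -, H⟩ :=
    Torus.classicalNS_continuation_of_posPart_tripleProduct_frac_rpow_integral_le_of_exponents
      (d := d) e hβ1 hβ2 hs ha hsa hν
  intro I
  by_contra hcon
  push Not at hcon
  exact Torus.classicalNS_not_continuation_of_not_bddAbove_gradNormSq' hν.le hT h hbu
    (H hT h hmean hw hNc hN0 hN hcon).2

/-- **The blow-up reading of Thm 1 (ii) at `1 < β < 2` on face (B): `α = ∞`.** If `T` IS a blow-up
time of the classical mean-zero solution, then for every `3 < γ < ∞` the norms `‖κ(t)‖_{L^γ}`,
`t ∈ [0, T)` (`κ` the printed factor in the frame `e`), are unbounded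
("`‖{…}₊‖_{L^{γ,∞}(Q_{T_*})} = ∞`").
[cite: ChaeLee2017, Thm 1 (ii) (1 < β < 2, 3 < γ < ∞, α = ∞)] -/
theorem Torus.forall_exists_lt_posPart_tripleProduct_frac_Lp_of_not_bddAbove_gradNormSq
    (e : d ≃ Fin 3) {β s : ℝ} (hβ1 : 1 < β) (hβ2 : β < 2) (hs : 3 < s) {ν T : ℝ} (hν : 0 < ν)
    (hT : 0 < T)
    {u : ℝ → UnitAddTorus d → EuclideanSpace ℝ d} {p : ℝ → UnitAddTorus d → ℝ}
    (h : Torus.IsClassicalNSSolutionOn (Ico 0 T) ν 0 u p)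
    (hmean : ∀ t ∈ Ico 0 T, Torus.HasZeroMean (u t)) {w : ℝ → d → UnitAddTorus d → ℝ}
    (hw : ∀ t k x, w t k x = Torus.partialDeriv (e.symm (e k + 1)) (u t) x (e.symm (e k + 2)) -
      Torus.partialDeriv (e.symm (e k + 2)) (u t) x (e.symm (e k + 1)))
    (hbu : ¬BddAbove ((fun t => Torus.gradNormSq (u t)) '' Ico 0 T)) :
    ∀ M : ℝ, ∃ t ∈ Ico 0 T,
      M < (∫ x, (max 0 ((∑ k, (u t x (e.symm (e k + 1)) * w t (e.symm (e k + 2)) x -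
        u t x (e.symm (e k + 2)) * w t (e.symm (e k + 1)) x) *
        Torus.fracLaplacian (β / 2) (u t) x k) /
        (Real.sqrt (∑ k, w t k x ^ 2) * ‖Torus.fracLaplacian (β / 2) (u t) x‖))) ^ s) ^
        (1 / s) := by
  obtain ⟨K, -, H⟩ :=
    Torus.classicalNS_continuation_of_posPart_tripleProduct_frac_Lp_le (d := d) e hβ1 hβ2 hs hν
  intro M
  by_contra hcon
  push Not at hcon
  exact Torus.classicalNS_not_continuation_of_not_bddAbove_gradNormSq' hν.le hT h hbu
    (H hT h hmean hw hcon).2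

end BetaFracPrinted

end Literature.Analysis.FluidPDE

namespace Literature.Analysis.FluidPDE

open Literature.Analysis.FunctionSpaces Literature.Analysis.FunctionSpaces.Torus

/-! ### §6 The «if» direction of Thm 1 (ii): EQUIVALENCE forms (levels `β = 2` and `1 < β < 2`)

The printed sentence is an «if and only if»: "`v` blows up at `T_*` … if and only if for all
`γ ∈ (3, ∞]` and `α ∈ [2, ∞]` with `3/γ + 2/α ≤ 1` and all `β ∈ [1, 2]`,
`‖{(v × ω/|ω|)·(Λ^β v/|Λ^β v|)}₊‖_{L^{γ,α}_{x,t}(Q_T)} = ∞`". §§2–5 and the companions type the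
«only if» half (blow-up ⇒ divergence on every face). The «if» half is the remark that WITHOUT
blow-up every face has a finite witness: if `‖∇u(t)‖₂` stays bounded on `[0, T)` the solution
continues past `T` (the tree's door `Torus.classicalNS_continuation_of_gradNormSq_le`, RRS Lemma
6.11), the continuation is jointly smooth on the compact `[0, T] × T^d` so `|u| ≤ C` there, and the
printed factor obeys `0 ≤ κ_β ≤ |u|` pointwise (Cauchy–Schwarz and Lagrange's identity), whence
`‖κ_β(t)‖_{L^γ} ≤ M₀` for all `t < T` and the constant majorant `N ≡ M₀` has bounded primitive
`∫₀ᵗ N^α ≤ M₀^α T`. Hence on EACH face, for EACH admissible pair `(γ, α)`: `T` is a blow-up time of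
the classical solution on `[0, T)` if and only if the face's quantity diverges (the printed
«for all» is the conjunction). Levels `β = 2` and `1 < β < 2` here; `β = 1` with the `β = 1` faces.
The parents' pointwise devices `posPart_le_norm` / `posPart_lambPairing_le_norm` being `private`,
the bound `κ ≤ |u|` is re-proved here directly in the frame (`posPart_cross_div_le_norm`). -/

namespace ChaeLee2017

variable {d : Type*} [Fintype d] [DecidableEq d]

omit [DecidableEq d] in
/-- **The printed factor is at most `|u|`, in a frame** (Cauchy–Schwarz and Lagrange's identity
`|U × O|² ≤ |U|²|O|²`): for `U, z ∈ ℝ^d` (`card d = 3` via a frame `e`) and `O : d → ℝ`,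
`max{0, ∑ₖ(U × O)ₖ zₖ / (|O| |z|)} ≤ |U|` (Lean's `a/0 = 0` where `O = 0` or `z = 0`).
(Proof device.) [folklore] -/
private theorem posPart_cross_div_le_norm (e : d ≃ Fin 3) (U : EuclideanSpace ℝ d) (O : d → ℝ)
    (z : EuclideanSpace ℝ d) :
    max 0 ((∑ k, (U (e.symm (e k + 1)) * O (e.symm (e k + 2)) -
        U (e.symm (e k + 2)) * O (e.symm (e k + 1))) * z k) /
        (Real.sqrt (∑ k, O k ^ 2) * ‖z‖)) ≤ ‖U‖ := by
  set V : Fin 3 → ℝ := fun a => U (e.symm a) with hV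
  set W : Fin 3 → ℝ := fun a => O (e.symm a) with hW
  set Z : Fin 3 → ℝ := fun a => z (e.symm a) with hZ
  have hre : ∀ G : d → ℝ, ∑ j, G j = ∑ b : Fin 3, G (e.symm b) := fun G =>
    Fintype.sum_equiv e _ _ fun j => by simp
  have hU2 : ‖U‖ ^ 2 = ∑ a : Fin 3, V a ^ 2 := by
    rw [EuclideanSpace.norm_sq_eq, hre]; simp [Real.norm_eq_abs, sq_abs, hV]
  have hz2 : ‖z‖ ^ 2 = ∑ a : Fin 3, Z a ^ 2 := by
    rw [EuclideanSpace.norm_sq_eq, hre]; simp [Real.norm_eq_abs, sq_abs, hZ]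
  have hO2 : ∑ k, O k ^ 2 = ∑ a : Fin 3, W a ^ 2 := by rw [hre]
  have hpair : ∑ k, (U (e.symm (e k + 1)) * O (e.symm (e k + 2)) -
      U (e.symm (e k + 2)) * O (e.symm (e k + 1))) * z k =
      ∑ a : Fin 3, (V (a + 1) * W (a + 2) - V (a + 2) * W (a + 1)) * Z a := by
    rw [hre]
    simp only [Equiv.apply_symm_apply, hV, hW, hZ]
  have h3 : (1 : Fin 3) + 1 = 2 ∧ (1 : Fin 3) + 2 = 0 ∧ (2 : Fin 3) + 1 = 0 ∧
      (2 : Fin 3) + 2 = 1 := by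
    decide
  obtain ⟨h11, h12, h21, h22⟩ := h3
  rw [hpair]
  simp only [Fin.sum_univ_three, zero_add, h11, h12, h21, h22] at hU2 hz2 hO2 ⊢
  rw [hO2]
  set q : ℝ := (V 1 * W 2 - V 2 * W 1) * Z 0 + (V 2 * W 0 - V 0 * W 2) * Z 1 +
    (V 0 * W 1 - V 1 * W 0) * Z 2 with hq
  set A : ℝ := V 0 ^ 2 + V 1 ^ 2 + V 2 ^ 2 with hA
  set B : ℝ := W 0 ^ 2 + W 1 ^ 2 + W 2 ^ 2 with hB
  set Cz : ℝ := Z 0 ^ 2 + Z 1 ^ 2 + Z 2 ^ 2 with hCz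
  have hA0 : 0 ≤ A := by positivity
  have hB0 : 0 ≤ B := by positivity
  have hC0 : 0 ≤ Cz := by positivity
  -- Lagrange's identity, twice (explicit, so that only linear arithmetic remains)
  have hlag_eq : (V 1 * W 2 - V 2 * W 1) ^ 2 + (V 2 * W 0 - V 0 * W 2) ^ 2 +
      (V 0 * W 1 - V 1 * W 0) ^ 2 = A * B - (V 0 * W 0 + V 1 * W 1 + V 2 * W 2) ^ 2 := by
    rw [hA, hB]; ring
  have hlag : (V 1 * W 2 - V 2 * W 1) ^ 2 + (V 2 * W 0 - V 0 * W 2) ^ 2 +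
      (V 0 * W 1 - V 1 * W 0) ^ 2 ≤ A * B := by
    rw [hlag_eq]; linarith [sq_nonneg (V 0 * W 0 + V 1 * W 1 + V 2 * W 2)]
  have hcs_eq : ((V 1 * W 2 - V 2 * W 1) ^ 2 + (V 2 * W 0 - V 0 * W 2) ^ 2 +
      (V 0 * W 1 - V 1 * W 0) ^ 2) * Cz - q ^ 2 =
      ((V 1 * W 2 - V 2 * W 1) * Z 1 - (V 2 * W 0 - V 0 * W 2) * Z 0) ^ 2 +
      ((V 1 * W 2 - V 2 * W 1) * Z 2 - (V 0 * W 1 - V 1 * W 0) * Z 0) ^ 2 +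
      ((V 2 * W 0 - V 0 * W 2) * Z 2 - (V 0 * W 1 - V 1 * W 0) * Z 1) ^ 2 := by
    rw [hq, hCz]; ring
  have hcs : q ^ 2 ≤ ((V 1 * W 2 - V 2 * W 1) ^ 2 + (V 2 * W 0 - V 0 * W 2) ^ 2 +
      (V 0 * W 1 - V 1 * W 0) ^ 2) * Cz := by
    linarith [hcs_eq, sq_nonneg ((V 1 * W 2 - V 2 * W 1) * Z 1 - (V 2 * W 0 - V 0 * W 2) * Z 0),
      sq_nonneg ((V 1 * W 2 - V 2 * W 1) * Z 2 - (V 0 * W 1 - V 1 * W 0) * Z 0),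
      sq_nonneg ((V 2 * W 0 - V 0 * W 2) * Z 2 - (V 0 * W 1 - V 1 * W 0) * Z 1)]
  have hq2 : q ^ 2 ≤ A * B * Cz := hcs.trans (mul_le_mul_of_nonneg_right hlag hC0)
  -- `|q| ≤ |U| · (√B · |z|)`
  have hUeq : ‖U‖ = Real.sqrt A := by
    rw [← Real.sqrt_sq (norm_nonneg U), hU2]
  have hzeq : ‖z‖ = Real.sqrt Cz := by
    rw [← Real.sqrt_sq (norm_nonneg z), hz2]
  set D : ℝ := Real.sqrt B * ‖z‖ with hD
  have hD0 : 0 ≤ D := by positivity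
  have hqD : |q| ≤ ‖U‖ * D := by
    rw [hD, hUeq, hzeq, ← Real.sqrt_mul hB0, ← Real.sqrt_mul hA0, ← Real.sqrt_sq_eq_abs]
    exact Real.sqrt_le_sqrt (by rw [← mul_assoc]; exact hq2)
  refine max_le (norm_nonneg _) ?_
  rcases hD0.eq_or_lt with hD00 | hDpos
  · rw [← hD00, div_zero]; exact norm_nonneg _
  · rw [div_le_iff₀ hDpos]; exact (le_abs_self q).trans hqD

omit [DecidableEq d] in
/-- The same with the opposite sign of the second vector (`(u × ω)·(−Δu)` at `β = 2`).
(Proof device.) [folklore] -/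
private theorem posPart_cross_div_le_norm_neg (e : d ≃ Fin 3) (U : EuclideanSpace ℝ d)
    (O : d → ℝ) (z : EuclideanSpace ℝ d) :
    max 0 ((∑ k, (U (e.symm (e k + 1)) * O (e.symm (e k + 2)) -
        U (e.symm (e k + 2)) * O (e.symm (e k + 1))) * (-z k)) /
        (Real.sqrt (∑ k, O k ^ 2) * ‖z‖)) ≤ ‖U‖ := by
  have h := posPart_cross_div_le_norm e U O (-z)
  simp only [PiLp.neg_apply, norm_neg] at h
  exact h

/-- **No blow-up at `T` ⇒ the velocity is bounded on `[0, T) × T^d`.** If `‖∇u(t)‖₂²` is bounded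
on `[0, T)` along a classical mean-zero solution of the unforced equations (`ν > 0`,
`card d = 3`), the solution continues to a classical solution on a closed `[0, T']`, `T' > T`
(`Torus.classicalNS_continuation_of_gradNormSq_le`), which is jointly smooth, hence bounded, on the
compact `[0, T] × T^d`. (Proof device.) [folklore] -/
private theorem exists_norm_le_of_bddAbove_gradNormSq (hd : Fintype.card d = 3) {ν T : ℝ}
    (hν : 0 < ν) (hT : 0 < T) {u : ℝ → UnitAddTorus d → EuclideanSpace ℝ d}
    {p : ℝ → UnitAddTorus d → ℝ} (h : Torus.IsClassicalNSSolutionOn (Ico 0 T) ν 0 u p)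
    (hmean : ∀ t ∈ Ico 0 T, Torus.HasZeroMean (u t))
    (hb : BddAbove ((fun t => Torus.gradNormSq (u t)) '' Ico 0 T)) :
    ∃ C : ℝ, 0 ≤ C ∧ ∀ t ∈ Ico 0 T, ∀ x, ‖u t x‖ ≤ C := by
  obtain ⟨E₁, hE₁⟩ := hb
  obtain ⟨T', hTT', u', p', h', -, hagree⟩ :=
    Torus.classicalNS_continuation_of_gradNormSq_le hd hν hT h hmean (E₁ := E₁)
      fun t ht => hE₁ ⟨t, ht, rfl⟩
  obtain ⟨C, hC⟩ := h'.smooth_velocity.exists_norm_le_of_isCompact isCompact_Icc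
    (Icc_subset_Icc_right hTT'.le)
  refine ⟨max C 0, le_max_right _ _, fun t ht x => ?_⟩
  rw [← hagree t ht]
  exact (hC t (Ico_subset_Icc_self ht) x).trans (le_max_left _ _)

omit [DecidableEq d] in
/-- A pointwise bound `0 ≤ κ ≤ C` on a slice bounds `(∫ κ^γ)^{1/γ}` by the slice-independent
`M₀ := (∫_{T^d} C^γ)^{1/γ}` (`γ > 0`; no measurability needed: `integral_mono_of_nonneg`).
(Proof device.) [folklore] -/
private theorem rpow_integral_rpow_le_of_le_const {κ : UnitAddTorus d → ℝ} {C s : ℝ} (hs : 0 < s)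
    (hκ0 : ∀ x, 0 ≤ κ x) (hκC : ∀ x, κ x ≤ C) :
    (∫ x, κ x ^ s) ^ (1 / s) ≤ (∫ _x : UnitAddTorus d, C ^ s) ^ (1 / s) := by
  have hC0 : 0 ≤ C := (hκ0 0).trans (hκC 0)
  have h1 : ∫ x, κ x ^ s ≤ ∫ _x : UnitAddTorus d, C ^ s :=
    integral_mono_of_nonneg (Eventually.of_forall fun x => Real.rpow_nonneg (hκ0 x) s)
      (integrable_const _)
      (Eventually.of_forall fun x => Real.rpow_le_rpow (hκ0 x) (hκC x) hs.le)
  exact Real.rpow_le_rpow (integral_nonneg fun x => Real.rpow_nonneg (hκ0 x) s) h1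
    (by positivity)

end ChaeLee2017

section BetaTwoIff

variable {d : Type*} [Fintype d] [DecidableEq d]
variable {ν T : ℝ} {u : ℝ → UnitAddTorus d → EuclideanSpace ℝ d} {p : ℝ → UnitAddTorus d → ℝ}

/-- **Thm 1 (ii) at `β = 2` on `T³` as the printed EQUIVALENCE, face (B): `3 < γ < ∞`, `α = ∞`.**
Along a classical mean-zero solution of the unforced equations (`ν > 0`) on `[0, T) × T^d`
(`card d = 3` via a frame `e`; `κ = {(u × ω/|ω|)·(−Δu/|Δu|)}₊`): `T` is a blow-up time
(`‖∇u(t)‖₂` unbounded on `[0, T)`) if and only if `sup_{t<T} ‖κ(t)‖_{L^γ} = ∞`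
("`‖{…}₊‖_{L^{γ,∞}_{x,t}(Q_T)} = ∞`"). «Only if»:
`Torus.forall_exists_lt_posPart_tripleProduct_Lp_of_not_bddAbove_gradNormSq`; «if»: without
blow-up `κ ≤ |u| ≤ C` on `[0, T) × T^d`.
[cite: ChaeLee2017, Thm 1 (ii) (β = 2, 3 < γ < ∞, α = ∞; «if and only if»)] -/
theorem Torus.not_bddAbove_gradNormSq_iff_forall_exists_lt_posPart_tripleProduct_Lp
    (e : d ≃ Fin 3) {s : ℝ} (hν : 0 < ν) (hT : 0 < T) (hs : 3 < s)
    (h : Torus.IsClassicalNSSolutionOn (Ico 0 T) ν 0 u p)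
    (hmean : ∀ t ∈ Ico 0 T, Torus.HasZeroMean (u t)) {w : ℝ → d → UnitAddTorus d → ℝ}
    (hw : ∀ t k x, w t k x = torusVorticityTensor (u t) (e.symm (e k + 1)) (e.symm (e k + 2)) x) :
    ¬BddAbove ((fun t => Torus.gradNormSq (u t)) '' Ico 0 T) ↔
      ∀ M : ℝ, ∃ t ∈ Ico 0 T,
        M < (∫ x, (max 0 ((∑ k, (u t x (e.symm (e k + 1)) * w t (e.symm (e k + 2)) x -
          u t x (e.symm (e k + 2)) * w t (e.symm (e k + 1)) x) * (-Torus.laplacian (u t) x k)) /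
          (Real.sqrt (∑ k, w t k x ^ 2) * ‖Torus.laplacian (u t) x‖))) ^ s) ^ (1 / s) := by
  have hd : Fintype.card d = 3 := by simpa using Fintype.card_congr e
  refine ⟨fun hbu => Torus.forall_exists_lt_posPart_tripleProduct_Lp_of_not_bddAbove_gradNormSq e
    hν hT hs h hmean hw hbu, fun H hb => ?_⟩
  obtain ⟨C, -, hC⟩ := ChaeLee2017.exists_norm_le_of_bddAbove_gradNormSq hd hν hT h hmean hb
  obtain ⟨t, ht, hlt⟩ := H ((∫ _x : UnitAddTorus d, C ^ s) ^ (1 / s))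
  exact (lt_irrefl _) (hlt.trans_le (ChaeLee2017.rpow_integral_rpow_le_of_le_const
    (by linarith) (fun x => le_max_left _ _) fun x =>
      (ChaeLee2017.posPart_cross_div_le_norm_neg e (u t x) (w t · x)
        (Torus.laplacian (u t) x)).trans (hC t ht x)))

/-- **Thm 1 (ii) at `β = 2` on `T³` as the printed EQUIVALENCE, face (A): `3 < γ < ∞`,
`2 ≤ α < ∞`, `3/γ + 2/α ≤ 1`.** `T` is a blow-up time of the classical mean-zero solution on
`[0, T)` if and only if for EVERY continuous majorant `N ≥ 0` of `‖κ(t)‖_{L^γ}` on `[0, T)` the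
primitive `∫₀ᵗ N^α` is unbounded ("`‖{…}₊‖_{L^{γ,α}_{x,t}(Q_T)} = ∞`"; `κ` the printed factor in the
frame `e`). «Only if»:
`Torus.forall_exists_lt_integral_posPartMajorant_of_not_bddAbove_gradNormSq_of_exponents`; «if»:
without blow-up the constant majorant `N ≡ M₀` has `∫₀ᵗ N^α ≤ M₀^α T`.
[cite: ChaeLee2017, Thm 1 (ii) (β = 2, 3 < γ < ∞, 2 ≤ α < ∞, 3/γ + 2/α ≤ 1; «if and only if»)] -/
theorem Torus.not_bddAbove_gradNormSq_iff_forall_majorant_exists_lt_integral_rpow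
    (e : d ≃ Fin 3) {s a : ℝ} (hν : 0 < ν) (hT : 0 < T) (hs : 3 < s) (ha : 2 ≤ a)
    (hsa : 3 / s + 2 / a ≤ 1)
    (h : Torus.IsClassicalNSSolutionOn (Ico 0 T) ν 0 u p)
    (hmean : ∀ t ∈ Ico 0 T, Torus.HasZeroMean (u t)) {w : ℝ → d → UnitAddTorus d → ℝ}
    (hw : ∀ t k x, w t k x = torusVorticityTensor (u t) (e.symm (e k + 1)) (e.symm (e k + 2)) x) :
    ¬BddAbove ((fun t => Torus.gradNormSq (u t)) '' Ico 0 T) ↔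
      ∀ N : ℝ → ℝ, ContinuousOn N (Ico 0 T) → (∀ t ∈ Ico 0 T, 0 ≤ N t) →
        (∀ t ∈ Ico 0 T, (∫ x, (max 0 ((∑ k, (u t x (e.symm (e k + 1)) * w t (e.symm (e k + 2)) x -
          u t x (e.symm (e k + 2)) * w t (e.symm (e k + 1)) x) * (-Torus.laplacian (u t) x k)) /
          (Real.sqrt (∑ k, w t k x ^ 2) * ‖Torus.laplacian (u t) x‖))) ^ s) ^ (1 / s) ≤ N t) →
        ∀ I : ℝ, ∃ t ∈ Ico 0 T, I < ∫ τ in (0 : ℝ)..t, N τ ^ a := by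
  have hd : Fintype.card d = 3 := by simpa using Fintype.card_congr e
  refine ⟨fun hbu N hNc hN0 hN =>
    Torus.forall_exists_lt_integral_posPartMajorant_of_not_bddAbove_gradNormSq_of_exponents e hν hT
      hs ha hsa h hmean hw hNc hN0 hN hbu, fun H hb => ?_⟩
  obtain ⟨C, -, hC⟩ := ChaeLee2017.exists_norm_le_of_bddAbove_gradNormSq hd hν hT h hmean hb
  set M₀ : ℝ := (∫ _x : UnitAddTorus d, C ^ s) ^ (1 / s) with hM₀
  have hM₀0 : 0 ≤ M₀ := Real.rpow_nonneg (integral_nonneg fun _ => Real.rpow_nonneg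
    ((norm_nonneg (u 0 0)).trans (hC 0 ⟨le_rfl, hT⟩ 0)) s) _
  obtain ⟨t, ht, hlt⟩ := H (fun _ => M₀) continuousOn_const (fun _ _ => hM₀0)
    (fun t ht => ChaeLee2017.rpow_integral_rpow_le_of_le_const (by linarith)
      (fun x => le_max_left _ _) fun x =>
        (ChaeLee2017.posPart_cross_div_le_norm_neg e (u t x) (w t · x)
          (Torus.laplacian (u t) x)).trans (hC t ht x))
    (M₀ ^ a * T)
  exact (lt_irrefl _) (hlt.trans_le (ChaeLee2017.integral_const_rpow_le hM₀0 ht))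

/-- **Thm 1 (ii) at `β = 2` on `T³` as the printed EQUIVALENCE, face (D): `γ = α = ∞`.** `T` is a
blow-up time of the classical mean-zero solution on `[0, T)` if and only if the printed factor `κ`
(frame `e`) is unbounded on `[0, T) × T^d` ("`‖{…}₊‖_{L^{∞,∞}_{x,t}(Q_T)} = ∞`"). «Only if»:
`Torus.classicalNS_continuation_of_posPart_tripleProduct_sup_le` read contrapositively
(`Torus.classicalNS_not_continuation_of_not_bddAbove_gradNormSq'`); «if»: `κ ≤ |u| ≤ C` without
blow-up. [cite: ChaeLee2017, Thm 1 (ii) (β = 2, γ = α = ∞; «if and only if»)] -/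
theorem Torus.not_bddAbove_gradNormSq_iff_forall_exists_lt_posPart_tripleProduct
    (e : d ≃ Fin 3) (hν : 0 < ν) (hT : 0 < T)
    (h : Torus.IsClassicalNSSolutionOn (Ico 0 T) ν 0 u p)
    (hmean : ∀ t ∈ Ico 0 T, Torus.HasZeroMean (u t)) {w : ℝ → d → UnitAddTorus d → ℝ}
    (hw : ∀ t k x, w t k x = torusVorticityTensor (u t) (e.symm (e k + 1)) (e.symm (e k + 2)) x) :
    ¬BddAbove ((fun t => Torus.gradNormSq (u t)) '' Ico 0 T) ↔
      ∀ M : ℝ, ∃ t ∈ Ico 0 T, ∃ x,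
        M < max 0 ((∑ k, (u t x (e.symm (e k + 1)) * w t (e.symm (e k + 2)) x -
          u t x (e.symm (e k + 2)) * w t (e.symm (e k + 1)) x) * (-Torus.laplacian (u t) x k)) /
          (Real.sqrt (∑ k, w t k x ^ 2) * ‖Torus.laplacian (u t) x‖)) := by
  have hd : Fintype.card d = 3 := by simpa using Fintype.card_congr e
  refine ⟨fun hbu M => ?_, fun H hb => ?_⟩
  · by_contra hcon
    push Not at hcon
    exact Torus.classicalNS_not_continuation_of_not_bddAbove_gradNormSq' hν.le hT h hbu
      (Torus.classicalNS_continuation_of_posPart_tripleProduct_sup_le e hν hT h hmean hw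
        fun t ht x => hcon t ht x)
  · obtain ⟨C, -, hC⟩ := ChaeLee2017.exists_norm_le_of_bddAbove_gradNormSq hd hν hT h hmean hb
    obtain ⟨t, ht, x, hlt⟩ := H C
    exact (lt_irrefl _) (hlt.trans_le ((ChaeLee2017.posPart_cross_div_le_norm_neg e (u t x)
      (w t · x) (Torus.laplacian (u t) x)).trans (hC t ht x)))

/-- **Thm 1 (ii) at `β = 2` on `T³` as the printed EQUIVALENCE, face (C): `γ = ∞`,
`2 ≤ α < ∞`.** `T` is a blow-up time of the classical mean-zero solution on `[0, T)` if and only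
if for EVERY continuous `N ≥ 0` on `[0, T)` dominating the printed factor pointwise
(`κ(t, x) ≤ N(t)`) the primitive `∫₀ᵗ N^α` is unbounded ("`‖{…}₊‖_{L^{∞,α}_{x,t}(Q_T)} = ∞`").
«Only if»: `Torus.classicalNS_continuation_of_posPart_tripleProduct_sup_rpow_integral_le` read
contrapositively; «if»: the constant majorant without blow-up.
[cite: ChaeLee2017, Thm 1 (ii) (β = 2, γ = ∞, 2 ≤ α < ∞; «if and only if»)] -/
theorem Torus.not_bddAbove_gradNormSq_iff_forall_supMajorant_exists_lt_integral_rpow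
    (e : d ≃ Fin 3) {a : ℝ} (hν : 0 < ν) (hT : 0 < T) (ha : 2 ≤ a)
    (h : Torus.IsClassicalNSSolutionOn (Ico 0 T) ν 0 u p)
    (hmean : ∀ t ∈ Ico 0 T, Torus.HasZeroMean (u t)) {w : ℝ → d → UnitAddTorus d → ℝ}
    (hw : ∀ t k x, w t k x = torusVorticityTensor (u t) (e.symm (e k + 1)) (e.symm (e k + 2)) x) :
    ¬BddAbove ((fun t => Torus.gradNormSq (u t)) '' Ico 0 T) ↔
      ∀ N : ℝ → ℝ, ContinuousOn N (Ico 0 T) → (∀ t ∈ Ico 0 T, 0 ≤ N t) →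
        (∀ t ∈ Ico 0 T, ∀ x, max 0 ((∑ k, (u t x (e.symm (e k + 1)) * w t (e.symm (e k + 2)) x -
          u t x (e.symm (e k + 2)) * w t (e.symm (e k + 1)) x) * (-Torus.laplacian (u t) x k)) /
          (Real.sqrt (∑ k, w t k x ^ 2) * ‖Torus.laplacian (u t) x‖)) ≤ N t) →
        ∀ I : ℝ, ∃ t ∈ Ico 0 T, I < ∫ τ in (0 : ℝ)..t, N τ ^ a := by
  have hd : Fintype.card d = 3 := by simpa using Fintype.card_congr e
  refine ⟨fun hbu N hNc hN0 hN I => ?_, fun H hb => ?_⟩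
  · by_contra hcon
    push Not at hcon
    exact Torus.classicalNS_not_continuation_of_not_bddAbove_gradNormSq' hν.le hT h hbu
      (Torus.classicalNS_continuation_of_posPart_tripleProduct_sup_rpow_integral_le e hν hT ha h
        hmean hw hNc hN0 hN hcon)
  · obtain ⟨C, hC0, hC⟩ := ChaeLee2017.exists_norm_le_of_bddAbove_gradNormSq hd hν hT h hmean hb
    obtain ⟨t, ht, hlt⟩ := H (fun _ => C) continuousOn_const (fun _ _ => hC0)
      (fun t ht x => (ChaeLee2017.posPart_cross_div_le_norm_neg e (u t x) (w t · x)
        (Torus.laplacian (u t) x)).trans (hC t ht x)) (C ^ a * T)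
    exact (lt_irrefl _) (hlt.trans_le (ChaeLee2017.integral_const_rpow_le hC0 ht))

end BetaTwoIff

section BetaFracIff

variable {d : Type*} [Fintype d] [DecidableEq d]

/-- **Thm 1 (ii) at `1 < β < 2` on `T³` as the printed EQUIVALENCE, face (B): `3 < γ < ∞`,
`α = ∞`.** Along a classical mean-zero solution of the unforced equations (`ν > 0`) on
`[0, T) × T^d` (`card d = 3` via a frame `e`; `κ = {(u × ω/|ω|)·(Λ^βu/|Λ^βu|)}₊`,
`Λ^β = (−Δ)^{β/2}`): `T` is a blow-up time if and only if `sup_{t<T} ‖κ(t)‖_{L^γ} = ∞`.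
«Only if»: `Torus.forall_exists_lt_posPart_tripleProduct_frac_Lp_of_not_bddAbove_gradNormSq`;
«if»: `κ ≤ |u| ≤ C` without blow-up.
[cite: ChaeLee2017, Thm 1 (ii) (1 < β < 2, 3 < γ < ∞, α = ∞; «if and only if»)] -/
theorem Torus.not_bddAbove_gradNormSq_iff_forall_exists_lt_posPart_tripleProduct_frac_Lp
    (e : d ≃ Fin 3) {β s : ℝ} (hβ1 : 1 < β) (hβ2 : β < 2) (hs : 3 < s) {ν T : ℝ} (hν : 0 < ν)
    (hT : 0 < T)
    {u : ℝ → UnitAddTorus d → EuclideanSpace ℝ d} {p : ℝ → UnitAddTorus d → ℝ}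
    (h : Torus.IsClassicalNSSolutionOn (Ico 0 T) ν 0 u p)
    (hmean : ∀ t ∈ Ico 0 T, Torus.HasZeroMean (u t)) {w : ℝ → d → UnitAddTorus d → ℝ}
    (hw : ∀ t k x, w t k x = Torus.partialDeriv (e.symm (e k + 1)) (u t) x (e.symm (e k + 2)) -
      Torus.partialDeriv (e.symm (e k + 2)) (u t) x (e.symm (e k + 1))) :
    ¬BddAbove ((fun t => Torus.gradNormSq (u t)) '' Ico 0 T) ↔
      ∀ M : ℝ, ∃ t ∈ Ico 0 T,
        M < (∫ x, (max 0 ((∑ k, (u t x (e.symm (e k + 1)) * w t (e.symm (e k + 2)) x -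
          u t x (e.symm (e k + 2)) * w t (e.symm (e k + 1)) x) *
          Torus.fracLaplacian (β / 2) (u t) x k) /
          (Real.sqrt (∑ k, w t k x ^ 2) * ‖Torus.fracLaplacian (β / 2) (u t) x‖))) ^ s) ^
          (1 / s) := by
  have hd : Fintype.card d = 3 := by simpa using Fintype.card_congr e
  refine ⟨fun hbu =>
    Torus.forall_exists_lt_posPart_tripleProduct_frac_Lp_of_not_bddAbove_gradNormSq e hβ1 hβ2 hs hν
      hT h hmean hw hbu, fun H hb => ?_⟩
  obtain ⟨C, -, hC⟩ := ChaeLee2017.exists_norm_le_of_bddAbove_gradNormSq hd hν hT h hmean hb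
  obtain ⟨t, ht, hlt⟩ := H ((∫ _x : UnitAddTorus d, C ^ s) ^ (1 / s))
  exact (lt_irrefl _) (hlt.trans_le (ChaeLee2017.rpow_integral_rpow_le_of_le_const
    (by linarith) (fun x => le_max_left _ _) fun x =>
      (ChaeLee2017.posPart_cross_div_le_norm e (u t x) (w t · x)
        (Torus.fracLaplacian (β / 2) (u t) x)).trans (hC t ht x)))

/-- **Thm 1 (ii) at `1 < β < 2` on `T³` as the printed EQUIVALENCE, face (A): `3 < γ < ∞`,
`2 ≤ α < ∞`, `3/γ + 2/α ≤ 1`.** `T` is a blow-up time of the classical mean-zero solution on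
`[0, T)` if and only if for EVERY continuous majorant `N ≥ 0` of `‖κ(t)‖_{L^γ}` on `[0, T)`
(`κ` the printed factor at level `β`, frame `e`) the primitive `∫₀ᵗ N^α` is unbounded. «Only if»:
`Torus.forall_exists_lt_integral_posPartMajorant_frac_of_not_bddAbove_gradNormSq_of_exponents`;
«if»: the constant majorant without blow-up.
[cite: ChaeLee2017, Thm 1 (ii) (1 < β < 2, 3 < γ < ∞, 2 ≤ α < ∞, 3/γ + 2/α ≤ 1;
«if and only if»)] -/
theorem Torus.not_bddAbove_gradNormSq_iff_forall_majorant_exists_lt_integral_rpow_frac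
    (e : d ≃ Fin 3) {β s a : ℝ} (hβ1 : 1 < β) (hβ2 : β < 2) (hs : 3 < s) (ha : 2 ≤ a)
    (hsa : 3 / s + 2 / a ≤ 1) {ν T : ℝ} (hν : 0 < ν) (hT : 0 < T)
    {u : ℝ → UnitAddTorus d → EuclideanSpace ℝ d} {p : ℝ → UnitAddTorus d → ℝ}
    (h : Torus.IsClassicalNSSolutionOn (Ico 0 T) ν 0 u p)
    (hmean : ∀ t ∈ Ico 0 T, Torus.HasZeroMean (u t)) {w : ℝ → d → UnitAddTorus d → ℝ}
    (hw : ∀ t k x, w t k x = Torus.partialDeriv (e.symm (e k + 1)) (u t) x (e.symm (e k + 2)) -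
      Torus.partialDeriv (e.symm (e k + 2)) (u t) x (e.symm (e k + 1))) :
    ¬BddAbove ((fun t => Torus.gradNormSq (u t)) '' Ico 0 T) ↔
      ∀ N : ℝ → ℝ, ContinuousOn N (Ico 0 T) → (∀ t ∈ Ico 0 T, 0 ≤ N t) →
        (∀ t ∈ Ico 0 T, (∫ x, (max 0 ((∑ k, (u t x (e.symm (e k + 1)) * w t (e.symm (e k + 2)) x -
          u t x (e.symm (e k + 2)) * w t (e.symm (e k + 1)) x) *
          Torus.fracLaplacian (β / 2) (u t) x k) /
          (Real.sqrt (∑ k, w t k x ^ 2) * ‖Torus.fracLaplacian (β / 2) (u t) x‖))) ^ s) ^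
          (1 / s) ≤ N t) →
        ∀ I : ℝ, ∃ t ∈ Ico 0 T, I < ∫ τ in (0 : ℝ)..t, N τ ^ a := by
  have hd : Fintype.card d = 3 := by simpa using Fintype.card_congr e
  refine ⟨fun hbu N hNc hN0 hN =>
    Torus.forall_exists_lt_integral_posPartMajorant_frac_of_not_bddAbove_gradNormSq_of_exponents e
      hβ1 hβ2 hs ha hsa hν hT h hmean hw hNc hN0 hN hbu, fun H hb => ?_⟩
  obtain ⟨C, -, hC⟩ := ChaeLee2017.exists_norm_le_of_bddAbove_gradNormSq hd hν hT h hmean hb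
  set M₀ : ℝ := (∫ _x : UnitAddTorus d, C ^ s) ^ (1 / s) with hM₀
  have hM₀0 : 0 ≤ M₀ := Real.rpow_nonneg (integral_nonneg fun _ => Real.rpow_nonneg
    ((norm_nonneg (u 0 0)).trans (hC 0 ⟨le_rfl, hT⟩ 0)) s) _
  obtain ⟨t, ht, hlt⟩ := H (fun _ => M₀) continuousOn_const (fun _ _ => hM₀0)
    (fun t ht => ChaeLee2017.rpow_integral_rpow_le_of_le_const (by linarith)
      (fun x => le_max_left _ _) fun x =>
        (ChaeLee2017.posPart_cross_div_le_norm e (u t x) (w t · x)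
          (Torus.fracLaplacian (β / 2) (u t) x)).trans (hC t ht x))
    (M₀ ^ a * T)
  exact (lt_irrefl _) (hlt.trans_le (ChaeLee2017.integral_const_rpow_le hM₀0 ht))

/-- **Thm 1 (ii) at `1 < β < 2` on `T³` as the printed EQUIVALENCE, face (D): `γ = α = ∞`.**
`T` is a blow-up time of the classical mean-zero solution on `[0, T)` if and only if the printed
factor `κ` at level `β` (frame `e`) is unbounded on `[0, T) × T^d`. «Only if»:
`Torus.classicalNS_continuation_of_posPart_tripleProduct_frac_sup_le` read contrapositively; «if»:
`κ ≤ |u| ≤ C` without blow-up.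
[cite: ChaeLee2017, Thm 1 (ii) (1 < β < 2, γ = α = ∞; «if and only if»)] -/
theorem Torus.not_bddAbove_gradNormSq_iff_forall_exists_lt_posPart_tripleProduct_frac
    (e : d ≃ Fin 3) {β : ℝ} (hβ1 : 1 < β) (hβ2 : β < 2) {ν T : ℝ} (hν : 0 < ν) (hT : 0 < T)
    {u : ℝ → UnitAddTorus d → EuclideanSpace ℝ d} {p : ℝ → UnitAddTorus d → ℝ}
    (h : Torus.IsClassicalNSSolutionOn (Ico 0 T) ν 0 u p)
    (hmean : ∀ t ∈ Ico 0 T, Torus.HasZeroMean (u t)) {w : ℝ → d → UnitAddTorus d → ℝ}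
    (hw : ∀ t k x, w t k x = Torus.partialDeriv (e.symm (e k + 1)) (u t) x (e.symm (e k + 2)) -
      Torus.partialDeriv (e.symm (e k + 2)) (u t) x (e.symm (e k + 1))) :
    ¬BddAbove ((fun t => Torus.gradNormSq (u t)) '' Ico 0 T) ↔
      ∀ M : ℝ, ∃ t ∈ Ico 0 T, ∃ x,
        M < max 0 ((∑ k, (u t x (e.symm (e k + 1)) * w t (e.symm (e k + 2)) x -
          u t x (e.symm (e k + 2)) * w t (e.symm (e k + 1)) x) *
          Torus.fracLaplacian (β / 2) (u t) x k) /
          (Real.sqrt (∑ k, w t k x ^ 2) * ‖Torus.fracLaplacian (β / 2) (u t) x‖)) := by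
  have hd : Fintype.card d = 3 := by simpa using Fintype.card_congr e
  refine ⟨fun hbu M => ?_, fun H hb => ?_⟩
  · by_contra hcon
    push Not at hcon
    exact Torus.classicalNS_not_continuation_of_not_bddAbove_gradNormSq' hν.le hT h hbu
      (Torus.classicalNS_continuation_of_posPart_tripleProduct_frac_sup_le e hβ1 hβ2 hν hT h hmean
        hw fun t ht x => hcon t ht x).2
  · obtain ⟨C, -, hC⟩ := ChaeLee2017.exists_norm_le_of_bddAbove_gradNormSq hd hν hT h hmean hb
    obtain ⟨t, ht, x, hlt⟩ := H C
    exact (lt_irrefl _) (hlt.trans_le ((ChaeLee2017.posPart_cross_div_le_norm e (u t x)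
      (w t · x) (Torus.fracLaplacian (β / 2) (u t) x)).trans (hC t ht x)))

/-- **Thm 1 (ii) at `1 < β < 2` on `T³` as the printed EQUIVALENCE, face (C): `γ = ∞`,
`2 ≤ α < ∞`.** `T` is a blow-up time of the classical mean-zero solution on `[0, T)` if and only
if for EVERY continuous `N ≥ 0` on `[0, T)` dominating the printed factor at level `β` pointwise
the primitive `∫₀ᵗ N^α` is unbounded. «Only if»:
`Torus.classicalNS_continuation_of_posPart_tripleProduct_frac_sup_rpow_integral_le` read
contrapositively; «if»: the constant majorant without blow-up.
[cite: ChaeLee2017, Thm 1 (ii) (1 < β < 2, γ = ∞, 2 ≤ α < ∞; «if and only if»)] -/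
theorem Torus.not_bddAbove_gradNormSq_iff_forall_supMajorant_exists_lt_integral_rpow_frac
    (e : d ≃ Fin 3) {β a : ℝ} (hβ1 : 1 < β) (hβ2 : β < 2) (ha : 2 ≤ a) {ν T : ℝ} (hν : 0 < ν)
    (hT : 0 < T)
    {u : ℝ → UnitAddTorus d → EuclideanSpace ℝ d} {p : ℝ → UnitAddTorus d → ℝ}
    (h : Torus.IsClassicalNSSolutionOn (Ico 0 T) ν 0 u p)
    (hmean : ∀ t ∈ Ico 0 T, Torus.HasZeroMean (u t)) {w : ℝ → d → UnitAddTorus d → ℝ}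
    (hw : ∀ t k x, w t k x = Torus.partialDeriv (e.symm (e k + 1)) (u t) x (e.symm (e k + 2)) -
      Torus.partialDeriv (e.symm (e k + 2)) (u t) x (e.symm (e k + 1))) :
    ¬BddAbove ((fun t => Torus.gradNormSq (u t)) '' Ico 0 T) ↔
      ∀ N : ℝ → ℝ, ContinuousOn N (Ico 0 T) → (∀ t ∈ Ico 0 T, 0 ≤ N t) →
        (∀ t ∈ Ico 0 T, ∀ x, max 0 ((∑ k, (u t x (e.symm (e k + 1)) * w t (e.symm (e k + 2)) x -
          u t x (e.symm (e k + 2)) * w t (e.symm (e k + 1)) x) *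
          Torus.fracLaplacian (β / 2) (u t) x k) /
          (Real.sqrt (∑ k, w t k x ^ 2) * ‖Torus.fracLaplacian (β / 2) (u t) x‖)) ≤ N t) →
        ∀ I : ℝ, ∃ t ∈ Ico 0 T, I < ∫ τ in (0 : ℝ)..t, N τ ^ a := by
  have hd : Fintype.card d = 3 := by simpa using Fintype.card_congr e
  refine ⟨fun hbu N hNc hN0 hN I => ?_, fun H hb => ?_⟩
  · by_contra hcon
    push Not at hcon
    exact Torus.classicalNS_not_continuation_of_not_bddAbove_gradNormSq' hν.le hT h hbu
      (Torus.classicalNS_continuation_of_posPart_tripleProduct_frac_sup_rpow_integral_le e hβ1 hβ2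
        ha hν hT h hmean hw hNc hN0 hN hcon).2
  · obtain ⟨C, hC0, hC⟩ := ChaeLee2017.exists_norm_le_of_bddAbove_gradNormSq hd hν hT h hmean hb
    obtain ⟨t, ht, hlt⟩ := H (fun _ => C) continuousOn_const (fun _ _ => hC0)
      (fun t ht x => (ChaeLee2017.posPart_cross_div_le_norm e (u t x) (w t · x)
        (Torus.fracLaplacian (β / 2) (u t) x)).trans (hC t ht x)) (C ^ a * T)
    exact (lt_irrefl _) (hlt.trans_le (ChaeLee2017.integral_const_rpow_le hC0 ht))

end BetaFracIff

end Literature.Analysis.FluidPDE
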